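import Literature.NumberTheory.Sieve.HeathBrownCubicApproxUB
import Literature.NumberTheory.Sieve.HeathBrownCubicTypeIIProofs
import HarnessLib

/-!
# Heath-Brown's Lemma 3.7 from Lemma 7.1, IX: `U₂^(1)` against the pair-level intermediate (Step I)

Pure-proof file (no definitions) in the deduction of **Lemma 3.7 from the corrected Lemma 7.1** of
D. R. Heath-Brown, *Primes represented by `x³ + 2y³`*, Acta Math. 186 (2001), 1–84, §7 pp. 42–47
(decomposition of **parity.S18**, `Literature.NumberTheory.Sieve.setOf_prime_cube_add_two_mul_cube_infinite`).

The last two conjuncts of Lemma 3.7 compare `U₂^(1)(𝒵) = ∑_{P₂ ≺ P₁, N(P₁P₂) ≥ X^{3/2+τ}} S_K(𝒵_{P₁P₂}, N(P₂))`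
(`U2one`) with `Û₂^(1)(𝒵)` (`U2hat`, pp. 16–17: "the rôles of `R` and `S` are reversed"). We split
the comparison (pp. 46–47) in three steps; this file is **Step I**: "we first restrict each of `P₁`
and `P₂` to have its norm in the relevant interval `J(n_i)`, and replace `S_K(𝒜_{P₁P₂}, N(P₂))` by
`S_K(𝒜_{P₁P₂}, X^{n₂ξ})`", i.e. `U₂^(1)` against
`V = ∑_{(n₁,n₂) ∈ nPairs} ∑_{P_j ∈ 𝒥(n_j)} S_K(𝒵_{P₁P₂}, X^{n₂ξ})`:

* `U2one_eq_sum`, `pairIndex_props`, `pairIndex_toChain_mem`, `pairIndex_toChain_injOn`,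
  `U2_pairs_abs_sub_le` — the matching `(𝐧, P₁, P₂) ↦ ({P₁}, P₂)` and the raw inequality
  (`abs_sub_le_of_matching`);
* `sum_sifted_le_of_h7` — Lemma 7.1 (normIn form) on `[2, X^{2−2τ})` at level `X^τ`
  ("in applying Lemma 7.1, we have `N(P₁P₂) ≤ X^{2−2τ}`", p. 47);
* `normIndex_props`, `chain1_props`, `U2_unmatched_pair_cases`, `classD2_window`,
  `U2_pair_pattern_weight_le`, `U2_unmatched_sum_le` — the unmatched good pairs lie in four
  edge/close classes of small pattern weight;
* `card_largePrimes_dvd_le_three`, `pair_eq_of_mul_eq`, `U2_buchstab_good_le`, `U2_closePairs_le`,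
  `buchstabCount_le_famCount` — the Buchstab range through the close pairs `P₂Q` with multiplicity
  `≤ 3` (p. 47: "`#{P₂ : P₁P₂ ∈ 𝒜_{Q₁⋯Q_{n+1}}} ≤ 1`"-type bound);
* `U2_pairs_bound_of_h7` — Step I assembled for a general family, with the raw family terms E1p
  (non-good pairs) and E3p (Buchstab primes of degree `≥ 2` / norm `N(P₂)`).
-/

noncomputable section

open Polynomial NumberField Finset Filter Topology Asymptotics
open scoped nonZeroDivisors

namespace Literature.NumberTheory.Sieve.CubicSieve

open LFunctions.CubeRootTwoField CubicPrimes
open Literature.NumberTheory.LFunctions (idealNormCount)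

section U2Pairs

variable {ι : Type*} (E : Finset ι) (I : ι → Ideal (𝓞 K)) {X τ : ℝ}

/-- `U₂^(1)` as a sum over the chain indices `({P_1}, P_2)` with `N(P_1P_2) ≥ X^{3/2+τ}` (p. 13).
[cite: HeathBrownActa2001, §3 p. 13] -/
theorem U2one_eq_sum (X τ : ℝ) :
    (U2one E I X τ : ℝ) = ∑ t ∈ (Upairs X τ 1).filter
        (fun t => X ^ (3 / 2 + τ) ≤ (Ideal.absNorm (uIdeal t) : ℝ)),
        (famSiftedAbove E I (uIdeal t) t.2 : ℝ) := by
  classical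
  rw [U2one, UpieceWhere_eq, Nat.cast_sum]
  refine sum_congr (filter_congr fun t _ => ?_) fun _ _ => rfl
  rw [absNorm_uIdeal, Nat.cast_mul]

variable {E I}

/-- **The pair indices of `V`**: for `(n₁, n₂) ∈ nPairs` and `P_j ∈ 𝒥(n_j)` (`0 < τ ≤ 1/4`, `X > 1`):
both primes are nonzero of prime norm, `X^τ ≤ X^{n₂ξ} ≤ N(P₂) < N(P₁) < X^{1−τ}`, `P₂ ≺ P₁`,
`X^{3/2+τ} ≤ N(P₁)N(P₂) < X^{2−2τ}`, and both lie in `𝒫₀`. [cite: HeathBrownActa2001, §3 p. 16] -/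
theorem pairIndex_props (hX : 1 < X) (hτ : 0 < τ) (hτ1 : τ ≤ 1 / 4)
    {a : Σ _ : ℕ × ℕ, Ideal (𝓞 K) × Ideal (𝓞 K)}
    (ha : a ∈ (nPairs τ).sigma (fun nn => Jprimes X τ nn.1 ×ˢ Jprimes X τ nn.2)) :
    (a.2.1.IsPrime ∧ a.2.1 ≠ ⊥ ∧ (Ideal.absNorm a.2.1).Prime ∧
      X ^ ((a.1.1 : ℝ) * hbXi τ) ≤ (Ideal.absNorm a.2.1 : ℝ) ∧
      (Ideal.absNorm a.2.1 : ℝ) < X ^ (((a.1.1 : ℝ) + 1) * hbXi τ)) ∧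
    (a.2.2.IsPrime ∧ a.2.2 ≠ ⊥ ∧ (Ideal.absNorm a.2.2).Prime ∧
      X ^ ((a.1.2 : ℝ) * hbXi τ) ≤ (Ideal.absNorm a.2.2 : ℝ) ∧
      (Ideal.absNorm a.2.2 : ℝ) < X ^ (((a.1.2 : ℝ) + 1) * hbXi τ)) ∧
    X ^ τ ≤ X ^ ((a.1.2 : ℝ) * hbXi τ) ∧
    (Ideal.absNorm a.2.2 : ℝ) < Ideal.absNorm a.2.1 ∧
    (Ideal.absNorm a.2.1 : ℝ) < X ^ (1 - τ) ∧
    X ^ (3 / 2 + τ) ≤ (Ideal.absNorm a.2.1 : ℝ) * Ideal.absNorm a.2.2 ∧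
    (Ideal.absNorm a.2.1 : ℝ) * Ideal.absNorm a.2.2 < X ^ (2 - 2 * τ) ∧
    PrimeLT a.2.2 a.2.1 ∧ a.2.1 ∈ smallPrimes X τ ∧ a.2.2 ∈ smallPrimes X τ := by
  have hξ := hbXi_pos hτ
  have hX0 : 0 < X := by linarith
  obtain ⟨hnn, hP⟩ := mem_sigma.mp ha
  obtain ⟨hP₁, hP₂⟩ := mem_product.mp hP
  obtain ⟨h1p, h10, h1lo, h1hi, h1n⟩ := (mem_Jprimes_iff X τ).mp hP₁
  obtain ⟨h2p, h20, h2lo, h2hi, h2n⟩ := (mem_Jprimes_iff X τ).mp hP₂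
  obtain ⟨hn2, h21, hn1, hsum⟩ := (mem_nPairs_iff hτ).mp hnn
  -- exponent facts
  have hτn₂ : τ ≤ (a.1.2 : ℝ) * hbXi τ := by rwa [div_le_iff₀ hξ] at hn2
  have h21' : ((a.1.2 : ℝ) + 1) * hbXi τ ≤ (a.1.1 : ℝ) * hbXi τ := by
    have : (a.1.2 : ℝ) + 1 ≤ a.1.1 := by exact_mod_cast h21
    exact mul_le_mul_of_nonneg_right this hξ.le
  have hn1' : ((a.1.1 : ℝ) + 1) * hbXi τ ≤ 1 - τ := by
    have h1 : (a.1.1 : ℝ) + 1 ≤ (1 - τ) / hbXi τ := by linarith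
    have := mul_le_mul_of_nonneg_right h1 hξ.le
    rwa [div_mul_cancel₀ _ hξ.ne'] at this
  have hsum' : 3 / 2 + τ ≤ ((a.1.1 : ℝ) + a.1.2) * hbXi τ := by
    have := mul_le_mul_of_nonneg_right hsum hξ.le
    rwa [div_mul_cancel₀ _ hξ.ne'] at this
  have hzτ : X ^ τ ≤ X ^ ((a.1.2 : ℝ) * hbXi τ) := Real.rpow_le_rpow_of_exponent_le hX.le hτn₂
  have h21N : (Ideal.absNorm a.2.2 : ℝ) < Ideal.absNorm a.2.1 :=
    lt_of_lt_of_le h2hi ((Real.rpow_le_rpow_of_exponent_le hX.le h21').trans h1lo)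
  have h1small : (Ideal.absNorm a.2.1 : ℝ) < X ^ (1 - τ) :=
    lt_of_lt_of_le h1hi (Real.rpow_le_rpow_of_exponent_le hX.le hn1')
  have hprodlo : X ^ (3 / 2 + τ) ≤ (Ideal.absNorm a.2.1 : ℝ) * Ideal.absNorm a.2.2 := by
    calc X ^ (3 / 2 + τ) ≤ X ^ (((a.1.1 : ℝ) + a.1.2) * hbXi τ) :=
          Real.rpow_le_rpow_of_exponent_le hX.le hsum'
      _ = X ^ ((a.1.1 : ℝ) * hbXi τ) * X ^ ((a.1.2 : ℝ) * hbXi τ) := by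
          rw [← Real.rpow_add hX0]; ring_nf
      _ ≤ _ := mul_le_mul h1lo h2lo (by positivity) (Nat.cast_nonneg _)
  have hprodhi : (Ideal.absNorm a.2.1 : ℝ) * Ideal.absNorm a.2.2 < X ^ (2 - 2 * τ) := by
    have h2small : (Ideal.absNorm a.2.2 : ℝ) < X ^ (1 - τ) := h21N.trans h1small
    calc (Ideal.absNorm a.2.1 : ℝ) * Ideal.absNorm a.2.2 < X ^ (1 - τ) * X ^ (1 - τ) :=
          mul_lt_mul'' h1small h2small (Nat.cast_nonneg _) (Nat.cast_nonneg _)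
      _ = X ^ (2 - 2 * τ) := by rw [← Real.rpow_add hX0]; ring_nf
  have hlt : PrimeLT a.2.2 a.2.1 := primeLT_of_absNorm_lt (by exact_mod_cast h21N)
  have hsm1 : a.2.1 ∈ smallPrimes X τ :=
    mem_smallPrimes_iff.mpr ⟨h1p, h10, (hzτ.trans h2lo).trans h21N.le, h1small⟩
  have hsm2 : a.2.2 ∈ smallPrimes X τ :=
    mem_smallPrimes_iff.mpr ⟨h2p, h20, hzτ.trans h2lo, h21N.trans h1small⟩
  exact ⟨⟨h1p, h10, h1n, h1lo, h1hi⟩, ⟨h2p, h20, h2n, h2lo, h2hi⟩, hzτ, h21N, h1small, hprodlo, hprodhi,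
    hlt, hsm1, hsm2⟩

/-- The pair index `(𝐧, (P₁, P₂))` gives the chain index `({P₁}, P₂)` of `U₂^(1)` (with
`N(P₁P₂) ≥ X^{3/2+τ}`). [cite: HeathBrownActa2001, §3 pp. 13, 16] -/
theorem pairIndex_toChain_mem (hX : 1 < X) (hτ : 0 < τ) (hτ1 : τ ≤ 1 / 4)
    {a : Σ _ : ℕ × ℕ, Ideal (𝓞 K) × Ideal (𝓞 K)}
    (ha : a ∈ (nPairs τ).sigma (fun nn => Jprimes X τ nn.1 ×ˢ Jprimes X τ nn.2)) :
    (({a.2.1} : Finset (Ideal (𝓞 K))), a.2.2) ∈ (Upairs X τ 1).filter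
        (fun t => X ^ (3 / 2 + τ) ≤ (Ideal.absNorm (uIdeal t) : ℝ)) ∧
      uIdeal (({a.2.1} : Finset (Ideal (𝓞 K))), a.2.2) = a.2.1 * a.2.2 := by
  classical
  have hX0 : 0 < X := by linarith
  obtain ⟨⟨h1p, h10, -, -, -⟩, -, -, -, h1small, hprodlo, -, hlt, hsm1, hsm2⟩ :=
    pairIndex_props hX hτ hτ1 ha
  have hu : uIdeal (({a.2.1} : Finset (Ideal (𝓞 K))), a.2.2) = a.2.1 * a.2.2 := by
    rw [uIdeal, prod_singleton]
  refine ⟨mem_filter.mpr ⟨mem_Upairs_iff.mpr ⟨?_, hsm2, ?_, ?_⟩, ?_⟩, hu⟩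
  · rw [mem_chains_iff]
    refine ⟨singleton_subset_iff.mpr hsm1, card_singleton _, ?_⟩
    rw [prod_singleton]
    exact lt_of_lt_of_le h1small (Real.rpow_le_rpow_of_exponent_le hX.le (by linarith))
  · intro P hP
    rw [mem_singleton] at hP; rw [hP]; exact hlt
  · rw [prod_singleton]; push_cast
    exact le_trans (Real.rpow_le_rpow_of_exponent_le hX.le (by linarith)) hprodlo
  · rw [hu, map_mul]; push_cast; exact hprodlo

/-- The map `(𝐧, (P₁, P₂)) ↦ ({P₁}, P₂)` is injective on the pair indices (`𝒥(n)` determines `n`).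
[folklore] -/
theorem pairIndex_toChain_injOn (hX : 1 < X) (hτ : 0 < τ) :
    Set.InjOn (fun a : (Σ _ : ℕ × ℕ, Ideal (𝓞 K) × Ideal (𝓞 K)) =>
        ((({a.2.1} : Finset (Ideal (𝓞 K))), a.2.2) : Finset (Ideal (𝓞 K)) × Ideal (𝓞 K)))
      ((nPairs τ).sigma (fun nn => Jprimes X τ nn.1 ×ˢ Jprimes X τ nn.2)) := by
  intro a ha a' ha' h
  simp only [Prod.mk.injEq, singleton_inj] at h
  obtain ⟨h1, h2⟩ := h
  obtain ⟨-, hP⟩ := mem_sigma.mp ha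
  obtain ⟨-, hP'⟩ := mem_sigma.mp ha'
  obtain ⟨hP₁, hP₂⟩ := mem_product.mp hP
  obtain ⟨hP₁', hP₂'⟩ := mem_product.mp hP'
  rw [h1] at hP₁; rw [h2] at hP₂
  have hn1 : a.1.1 = a'.1.1 := Jprimes_index_unique hX hτ hP₁ hP₁'
  have hn2 : a.1.2 = a'.1.2 := Jprimes_index_unique hX hτ hP₂ hP₂'
  obtain ⟨nn, P₁, P₂⟩ := a
  obtain ⟨nn', P₁', P₂'⟩ := a'
  simp only at h1 h2 hn1 hn2 ⊢
  subst h1; subst h2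
  have : nn = nn' := Prod.ext hn1 hn2
  subst this
  rfl

open scoped Classical in
/-- **Step I, raw form: `U₂^(1)` against the pair-level intermediate**
`V = ∑_{(𝐧,P₁,P₂)} S_K(𝒵_{P₁P₂}, X^{n₂ξ})`:
`|U₂^(1) − V| ≤ ∑_{unmatched ({P₁},P₂)} S_K^≺(𝒵_{P₁P₂}, P₂) + ∑_{(𝐧,P₁,P₂)} (S_K(𝒵_{P₁P₂}, X^{n₂ξ}) − S_K^≺(𝒵_{P₁P₂}, P₂))`
(`abs_sub_le_of_matching` with `({P₁}, P₂) ↤ (𝐧, P₁, P₂)`; p. 46: "we first restrict each of `P₁` and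
`P₂` to have its norm in the relevant interval `J(n_i)`, and replace `S_K(𝒜_{P₁P₂}, N(P₂))` by
`S_K(𝒜_{P₁P₂}, X^{n₂ξ})`"). [cite: HeathBrownActa2001, §7 p. 46] -/
theorem U2_pairs_abs_sub_le (hX : 1 < X) (hτ : 0 < τ) (hτ1 : τ ≤ 1 / 4) :
    |(U2one E I X τ : ℝ) -
        ∑ a ∈ (nPairs τ).sigma (fun nn => Jprimes X τ nn.1 ×ˢ Jprimes X τ nn.2),
          (famSifted E I (a.2.1 * a.2.2) (X ^ ((a.1.2 : ℝ) * hbXi τ)) : ℝ)| ≤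
      ∑ t ∈ ((Upairs X τ 1).filter (fun t => X ^ (3 / 2 + τ) ≤ (Ideal.absNorm (uIdeal t) : ℝ))).filter
          (fun t => t ∉ ((nPairs τ).sigma (fun nn => Jprimes X τ nn.1 ×ˢ Jprimes X τ nn.2)).image
            (fun a : (Σ _ : ℕ × ℕ, Ideal (𝓞 K) × Ideal (𝓞 K)) =>
              ((({a.2.1} : Finset (Ideal (𝓞 K))), a.2.2) : Finset (Ideal (𝓞 K)) × Ideal (𝓞 K)))),
        (famSiftedAbove E I (uIdeal t) t.2 : ℝ) +
      ∑ a ∈ (nPairs τ).sigma (fun nn => Jprimes X τ nn.1 ×ˢ Jprimes X τ nn.2),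
        ((famSifted E I (a.2.1 * a.2.2) (X ^ ((a.1.2 : ℝ) * hbXi τ)) : ℝ) -
          famSiftedAbove E I (a.2.1 * a.2.2) a.2.2) := by
  classical
  set R₂ := (Upairs X τ 1).filter (fun t => X ^ (3 / 2 + τ) ≤ (Ideal.absNorm (uIdeal t) : ℝ)) with hR₂
  set A₁ := (nPairs τ).sigma (fun nn => Jprimes X τ nn.1 ×ˢ Jprimes X τ nn.2) with hA₁
  set φ : (Σ _ : ℕ × ℕ, Ideal (𝓞 K) × Ideal (𝓞 K)) → Finset (Ideal (𝓞 K)) × Ideal (𝓞 K) :=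
    fun a => ((({a.2.1} : Finset (Ideal (𝓞 K))), a.2.2)) with hφ
  set F : Finset (Ideal (𝓞 K)) × Ideal (𝓞 K) → ℝ := fun t => (famSiftedAbove E I (uIdeal t) t.2 : ℝ)
    with hF
  set G : (Σ _ : ℕ × ℕ, Ideal (𝓞 K) × Ideal (𝓞 K)) → ℝ :=
    fun a => (famSifted E I (a.2.1 * a.2.2) (X ^ ((a.1.2 : ℝ) * hbXi τ)) : ℝ) with hG
  have hφmem : ∀ a ∈ A₁, φ a ∈ R₂ := fun a ha => (pairIndex_toChain_mem hX hτ hτ1 ha).1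
  have hinj : Set.InjOn φ A₁ := pairIndex_toChain_injOn hX hτ
  have hFG : ∀ a ∈ A₁, F (φ a) ≤ G a := by
    intro a ha
    obtain ⟨-, ⟨-, -, -, h2lo, -⟩, -⟩ := pairIndex_props hX hτ hτ1 ha
    simp only [hF, hG, hφ]
    rw [(pairIndex_toChain_mem hX hτ hτ1 ha).2]
    exact_mod_cast famSiftedAbove_le_famSifted E I _ _ h2lo
  have h := abs_sub_le_of_matching R₂ A₁ F G G (fun _ => (1 : ℝ)) φ hφmem hinj
    (fun _ _ => Nat.cast_nonneg _) (fun _ _ => Nat.cast_nonneg _) (fun _ _ => le_rfl) hFG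
    (fun _ _ => le_rfl)
  rw [U2one_eq_sum]
  simp only [one_mul, sub_self, zero_mul, add_zero] at h
  convert h using 3
  rename_i a ha
  simp only [hG, hF, hφ]
  rw [(pairIndex_toChain_mem hX hτ hτ1 ha).2]

end U2Pairs


/-! ## Part B: Lemma 7.1 wrapper, unmatched pairs, and their pattern weights -/

section U2PairsB

variable {ι : Type*} (E : Finset ι) (I : ι → Ideal (𝓞 K)) {X τ C₇ C₁ M Err : ℝ}

/-- **Lemma 7.1 (normIn form) for any finite set of ideals of square-free norm in `[2, X^{2−2τ})`,
level `X^τ`**: `∑_{Q∈T} S_K(𝒵_Q, X^τ) ≤ C₇ (M/(τ log X)) ∑_{q ∈ N(T)} c_K(q)/q + 3 log X · C₇ Err`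
(`sum_le_of_image_normIn` with `b = X^{2−2τ}`, where `min(X^τ, X^{2−τ}/b) = X^τ`).
[cite: HeathBrownActa2001, §7 (7.3)] -/
theorem sum_sifted_le_of_h7 (hX : (2 : ℝ) ^ 15 ≤ X) (hτ : 0 < τ) (hτ1 : τ ≤ 1 / 8)
    (hC₇ : 0 ≤ C₇) (hM : 0 ≤ M) (hErr : 0 ≤ Err)
    (h7 : ∀ (N z : ℝ) (𝒬 : Finset ℕ), X ^ τ ≤ z → 0 < N → N ≤ X ^ (2 - 2 * τ) →
        (∀ q ∈ 𝒬, Squarefree q ∧ N < q ∧ (q : ℝ) ≤ 2 * N) →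
        ∑ Q ∈ normIn 𝒬, (famSifted E I Q z : ℝ) ≤
          C₇ * (M / Real.log (min z (X ^ (2 - τ) / N)) *
            ∑ Q ∈ normIn 𝒬, ((Ideal.absNorm Q : ℕ) : ℝ)⁻¹ + Err))
    (T : Finset (Ideal (𝓞 K)))
    (hT : ∀ Q ∈ T, Squarefree (Ideal.absNorm Q) ∧ (2 : ℝ) ≤ (Ideal.absNorm Q : ℝ) ∧
      (Ideal.absNorm Q : ℝ) < X ^ (2 - 2 * τ)) :
    ∑ Q ∈ T, (famSifted E I Q (X ^ τ) : ℝ) ≤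
      C₇ * (M / (τ * Real.log X)) * ∑ q ∈ T.image Ideal.absNorm, (idealNormCount K q : ℝ) * (q : ℝ)⁻¹ +
        3 * Real.log X * (C₇ * Err) := by
  classical
  have hX1 : 1 < X := lt_of_lt_of_le (by norm_num) hX
  have hX0 : 0 < X := by linarith
  set L := Real.log X with hL
  have hL10 : 10 ≤ L := ten_le_log hX
  set b : ℝ := X ^ (2 - 2 * τ) with hb
  have hab : (2 : ℝ) ≤ b := by
    have : X ^ (1 : ℝ) ≤ X ^ (2 - 2 * τ) := Real.rpow_le_rpow_of_exponent_le hX1.le (by linarith)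
    rw [Real.rpow_one] at this; rw [hb]; linarith
  have hmin : min (X ^ τ) (X ^ (2 - τ) / b) = X ^ τ := by
    have : X ^ (2 - τ) / b = X ^ τ := by
      rw [hb, ← Real.rpow_sub hX0]; ring_nf
    rw [this, min_self]
  have hm1 : 1 < min (X ^ τ) (X ^ (2 - τ) / b) := by rw [hmin]; exact Real.one_lt_rpow hX1 hτ
  have hlogmin : Real.log (min (X ^ τ) (X ^ (2 - τ) / b)) = τ * L := by rw [hmin, Real.log_rpow hX0]
  have h7z : ∀ (N : ℝ) (𝒬 : Finset ℕ), 0 < N → N ≤ X ^ (2 - 2 * τ) →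
      (∀ q ∈ 𝒬, Squarefree q ∧ N < q ∧ (q : ℝ) ≤ 2 * N) →
      ∑ Q ∈ normIn 𝒬, (famSifted E I Q (X ^ τ) : ℝ) ≤
        C₇ * (M / Real.log (min (X ^ τ) (X ^ (2 - τ) / N)) *
          ∑ Q ∈ normIn 𝒬, ((Ideal.absNorm Q : ℕ) : ℝ)⁻¹ + Err) :=
    fun N 𝒬 hN hNX h𝒬 => h7 N (X ^ τ) 𝒬 le_rfl hN hNX h𝒬
  have step2 := sum_le_of_image_normIn (fun Q => Nat.cast_nonneg _) h7z hC₇ hM hErr hX0 le_rfl hab le_rfl hm1 T hT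
  rw [hlogmin] at step2
  have hblocks : Real.log b / Real.log 2 + 1 ≤ 3 * L := by
    refine log_div_log_two_add_one_le (by linarith) ?_ hL hL10
    calc b ≤ X ^ ((2 : ℕ) : ℝ) := Real.rpow_le_rpow_of_exponent_le hX1.le (by norm_num; linarith)
      _ = X ^ 2 := Real.rpow_natCast X 2
  have hcoef : 0 ≤ C₇ * (M / (τ * L)) := by positivity
  calc ∑ Q ∈ T, (famSifted E I Q (X ^ τ) : ℝ)
      ≤ C₇ * (M / (τ * L) * ∑ q ∈ T.image Ideal.absNorm, (idealNormCount K q : ℝ) * (q : ℝ)⁻¹) +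
          (Real.log b / Real.log 2 + 1) * (C₇ * Err) := step2
    _ ≤ _ := by
        rw [← mul_assoc]
        exact add_le_add le_rfl (mul_le_mul_of_nonneg_right hblocks (by positivity))

variable {E I}

/-- The norm index of a prime: `n = ⌊log N(P)/(ξ log X)⌋` has `X^{nξ} ≤ N(P) < X^{(n+1)ξ}`
(`N(P) ≥ 1`, `X > 1`, `ξ > 0`). [folklore] -/
theorem normIndex_props (hX : 1 < X) (hτ : 0 < τ) {N : ℝ} (hN : 1 ≤ N) :
    X ^ ((⌊Real.log N / (hbXi τ * Real.log X)⌋₊ : ℝ) * hbXi τ) ≤ N ∧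
      N < X ^ (((⌊Real.log N / (hbXi τ * Real.log X)⌋₊ : ℝ) + 1) * hbXi τ) := by
  have hξ := hbXi_pos hτ
  have hX0 : 0 < X := by linarith
  have hL : 0 < Real.log X := Real.log_pos hX
  have hξL : 0 < hbXi τ * Real.log X := by positivity
  set y : ℝ := Real.log N / (hbXi τ * Real.log X) with hy
  have hy0 : 0 ≤ y := div_nonneg (Real.log_nonneg hN) hξL.le
  have hfl : (⌊y⌋₊ : ℝ) ≤ y := Nat.floor_le hy0
  have hlt : y < (⌊y⌋₊ : ℝ) + 1 := Nat.lt_floor_add_one y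
  have hN0 : 0 < N := by linarith
  have hlogN : Real.log N = y * (hbXi τ * Real.log X) := by rw [hy]; field_simp
  constructor
  · rw [Real.rpow_def_of_pos hX0, ← Real.exp_log hN0, Real.exp_le_exp, hlogN]
    nlinarith
  · rw [Real.rpow_def_of_pos hX0, ← Real.exp_log hN0, Real.exp_lt_exp, hlogN]
    nlinarith

/-- A good chain index of `U^(1)` is `({P₁}, P₂)` with `P₂ ≺ P₁` of prime, distinct norms,
`N(P₂) < N(P₁)`. [folklore] -/
theorem chain1_props {t : Finset (Ideal (𝓞 K)) × Ideal (𝓞 K)} (ht : t ∈ Upairs X τ 1) (hg : UGood t) :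
    ∃ P₁ : Ideal (𝓞 K), t.1 = {P₁} ∧ P₁ ∈ smallPrimes X τ ∧ t.2 ∈ smallPrimes X τ ∧ PrimeLT t.2 P₁ ∧
      (Ideal.absNorm P₁).Prime ∧ (Ideal.absNorm t.2).Prime ∧ Ideal.absNorm t.2 < Ideal.absNorm P₁ ∧
      uIdeal t = P₁ * t.2 := by
  classical
  have hmem := mem_Upairs_iff.mp ht
  obtain ⟨hsub, hcard, -⟩ := mem_chains_iff.mp hmem.1
  obtain ⟨P₁, hP₁⟩ := card_eq_one.mp hcard
  have hP₁mem : P₁ ∈ t.1 := by rw [hP₁]; exact mem_singleton_self _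
  have hlt : PrimeLT t.2 P₁ := hmem.2.2.1 P₁ hP₁mem
  have hne : t.2 ≠ P₁ := hlt.ne
  have hn1 : (Ideal.absNorm P₁).Prime := hg.1 P₁ (mem_insert_of_mem hP₁mem)
  have hn2 : (Ideal.absNorm t.2).Prime := hg.1 t.2 (mem_insert_self _ _)
  have hNne : Ideal.absNorm t.2 ≠ Ideal.absNorm P₁ := fun h =>
    hne (hg.2 (mem_insert_self _ _) (mem_insert_of_mem hP₁mem) h)
  have hNlt : Ideal.absNorm t.2 < Ideal.absNorm P₁ := lt_of_le_of_ne hlt.absNorm_le hNne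
  refine ⟨P₁, hP₁, hsub hP₁mem, hmem.2.1, hlt, hn1, hn2, hNlt, ?_⟩
  rw [uIdeal, hP₁, prod_singleton]

/-- **An unmatched good pair lies in one of four boundary/close classes.** If `({P₁}, P₂)` is a good
chain index with `N(P₁P₂) ≥ X^{3/2+τ}` which is not `({P₁}, P₂)` for any pair index
`(𝐧, P₁, P₂)`, `𝐧 ∈ nPairs`, `P_j ∈ 𝒥(n_j)`, then `N(P₂) < X^{τ+ξ}`, or `N(P₁) ≥ X^{1−τ−ξ}`, or
`N(P₁) < N(P₂)X^ξ`, or `N(P₁P₂) < X^{3/2+τ+2ξ}` (otherwise `n_j = ⌊log N(P_j)/(ξ log X)⌋` works).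
[cite: HeathBrownActa2001, §7 p. 46] -/
theorem U2_unmatched_pair_cases (hX : 1 < X) (hτ : 0 < τ)
    {t : Finset (Ideal (𝓞 K)) × Ideal (𝓞 K)} (ht : t ∈ Upairs X τ 1) (hg : UGood t)
    (hun : t ∉ ((nPairs τ).sigma (fun nn => Jprimes X τ nn.1 ×ˢ Jprimes X τ nn.2)).image
      (fun a : (Σ _ : ℕ × ℕ, Ideal (𝓞 K) × Ideal (𝓞 K)) =>
        ((({a.2.1} : Finset (Ideal (𝓞 K))), a.2.2) : Finset (Ideal (𝓞 K)) × Ideal (𝓞 K)))) :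
    (∃ Q ∈ insert t.2 t.1, (Ideal.absNorm Q : ℝ) < X ^ (τ + hbXi τ)) ∨
    (∃ Q ∈ insert t.2 t.1, X ^ (1 - τ - hbXi τ) ≤ (Ideal.absNorm Q : ℝ)) ∨
    (∃ Q ∈ insert t.2 t.1, ∃ Q' ∈ insert t.2 t.1, Ideal.absNorm Q < Ideal.absNorm Q' ∧
      (Ideal.absNorm Q' : ℝ) < Ideal.absNorm Q * X ^ hbXi τ) ∨
    ((Ideal.absNorm (uIdeal t) : ℝ) < X ^ (3 / 2 + τ + 2 * hbXi τ)) := by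
  classical
  have hξ := hbXi_pos hτ
  have hX0 : 0 < X := by linarith
  have hL : 0 < Real.log X := Real.log_pos hX
  have hξL : 0 < hbXi τ * Real.log X := by positivity
  obtain ⟨P₁, ht1, hsm1, hsm2, hlt, hn1, hn2, hNlt, hu⟩ := chain1_props ht hg
  by_contra h
  simp only [not_or, not_exists, not_and, not_lt, not_le] at h
  obtain ⟨na, nb, ne, nf⟩ := h
  have hP₁ins : P₁ ∈ insert t.2 t.1 := by rw [ht1]; exact mem_insert_of_mem (mem_singleton_self _)
  have hP₂ins : t.2 ∈ insert t.2 t.1 := mem_insert_self _ _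
  obtain ⟨h1p, h10, h1lo, h1hi⟩ := mem_smallPrimes_iff.mp hsm1
  obtain ⟨h2p, h20, h2lo, h2hi⟩ := mem_smallPrimes_iff.mp hsm2
  have hXτ1 : 1 ≤ X ^ τ := Real.one_le_rpow hX.le hτ.le
  have hN1 : (1 : ℝ) ≤ Ideal.absNorm P₁ := hXτ1.trans ((h2lo.trans (by exact_mod_cast hNlt.le)))
  have hN2 : (1 : ℝ) ≤ Ideal.absNorm t.2 := hXτ1.trans h2lo
  -- the indices
  set n₁ := ⌊Real.log (Ideal.absNorm P₁ : ℝ) / (hbXi τ * Real.log X)⌋₊ with hn₁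
  set n₂ := ⌊Real.log (Ideal.absNorm t.2 : ℝ) / (hbXi τ * Real.log X)⌋₊ with hn₂
  obtain ⟨h1l, h1u⟩ := normIndex_props hX hτ hN1
  obtain ⟨h2l, h2u⟩ := normIndex_props hX hτ hN2
  rw [← hn₁] at h1l h1u
  rw [← hn₂] at h2l h2u
  have hJ1 : P₁ ∈ Jprimes X τ n₁ := (mem_Jprimes_iff X τ).mpr ⟨h1p, h10, h1l, h1u, hn1⟩
  have hJ2 : t.2 ∈ Jprimes X τ n₂ := (mem_Jprimes_iff X τ).mpr ⟨h2p, h20, h2l, h2u, hn2⟩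
  -- real versions of the floors
  set y₁ : ℝ := Real.log (Ideal.absNorm P₁ : ℝ) / (hbXi τ * Real.log X) with hy₁
  set y₂ : ℝ := Real.log (Ideal.absNorm t.2 : ℝ) / (hbXi τ * Real.log X) with hy₂
  have hy₁0 : 0 ≤ y₁ := div_nonneg (Real.log_nonneg hN1) hξL.le
  have hy₂0 : 0 ≤ y₂ := div_nonneg (Real.log_nonneg hN2) hξL.le
  have hfl1 : (n₁ : ℝ) ≤ y₁ := Nat.floor_le hy₁0
  have hlt1 : y₁ < (n₁ : ℝ) + 1 := Nat.lt_floor_add_one y₁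
  have hfl2 : (n₂ : ℝ) ≤ y₂ := Nat.floor_le hy₂0
  have hlt2 : y₂ < (n₂ : ℝ) + 1 := Nat.lt_floor_add_one y₂
  have hlog1 : Real.log (Ideal.absNorm P₁ : ℝ) = y₁ * (hbXi τ * Real.log X) := by rw [hy₁]; field_simp
  have hlog2 : Real.log (Ideal.absNorm t.2 : ℝ) = y₂ * (hbXi τ * Real.log X) := by rw [hy₂]; field_simp
  clear_value y₁ y₂ n₁ n₂
  clear h1l h1u h2l h2u
  have hN1pos : (0 : ℝ) < Ideal.absNorm P₁ := by linarith
  have hN2pos : (0 : ℝ) < Ideal.absNorm t.2 := by linarith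
  -- translate the four negated classes into bounds on `y₁`, `y₂`
  -- (a) `N(P₂) ≥ X^{τ+ξ}` ⇒ `y₂ ≥ τ/ξ + 1`
  have ha' : τ / hbXi τ + 1 ≤ y₂ := by
    have h := na t.2 hP₂ins
    have h' : (τ + hbXi τ) * Real.log X ≤ Real.log (Ideal.absNorm t.2 : ℝ) := by
      rw [← Real.log_rpow hX0]; exact Real.log_le_log (Real.rpow_pos_of_pos hX0 _) h
    rw [hlog2] at h'
    rw [div_add_one hξ.ne', div_le_iff₀ hξ]
    nlinarith
  -- (b) `N(P₁) < X^{1−τ−ξ}` ⇒ `y₁ < (1−τ)/ξ − 1`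
  have hb' : y₁ < (1 - τ) / hbXi τ - 1 := by
    have h := nb P₁ hP₁ins
    have h' : Real.log (Ideal.absNorm P₁ : ℝ) < (1 - τ - hbXi τ) * Real.log X := by
      rw [← Real.log_rpow hX0]; exact Real.log_lt_log hN1pos h
    rw [hlog1] at h'
    have h3 : (y₁ + 1) * hbXi τ < 1 - τ := by nlinarith
    have h4 : y₁ + 1 < (1 - τ) / hbXi τ := by rwa [lt_div_iff₀ hξ]
    linarith
  -- (e) `N(P₁) ≥ N(P₂) X^ξ` ⇒ `y₁ ≥ y₂ + 1`
  have he' : y₂ + 1 ≤ y₁ := by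
    have h := ne t.2 hP₂ins P₁ hP₁ins hNlt
    have h' : Real.log (Ideal.absNorm t.2 : ℝ) + hbXi τ * Real.log X ≤ Real.log (Ideal.absNorm P₁ : ℝ) := by
      rw [← Real.log_rpow hX0, ← Real.log_mul hN2pos.ne' (Real.rpow_pos_of_pos hX0 _).ne']
      exact Real.log_le_log (by positivity) h
    rw [hlog1, hlog2] at h'
    nlinarith
  -- (f) `N(P₁P₂) ≥ X^{3/2+τ+2ξ}` ⇒ `y₁ + y₂ ≥ (3/2+τ)/ξ + 2`
  have hf' : (3 / 2 + τ) / hbXi τ + 2 ≤ y₁ + y₂ := by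
    have h := nf
    rw [hu, map_mul, Nat.cast_mul] at h
    have h' : (3 / 2 + τ + 2 * hbXi τ) * Real.log X ≤
        Real.log (Ideal.absNorm P₁ : ℝ) + Real.log (Ideal.absNorm t.2 : ℝ) := by
      rw [← Real.log_rpow hX0, ← Real.log_mul hN1pos.ne' hN2pos.ne']
      exact Real.log_le_log (Real.rpow_pos_of_pos hX0 _) h
    rw [hlog1, hlog2] at h'
    rw [div_add' _ _ _ hξ.ne', div_le_iff₀ hξ]
    nlinarith
  -- hence `(n₁, n₂) ∈ nPairs`
  have hnn : (n₁, n₂) ∈ nPairs τ := by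
    rw [mem_nPairs_iff hτ]
    refine ⟨?_, ?_, ?_, ?_⟩
    · show τ / hbXi τ ≤ (n₂ : ℝ)
      linarith only [ha', hlt2]
    · show n₂ < n₁
      have h5 : (n₂ : ℝ) < n₁ := by linarith only [he', hfl2, hlt1]
      exact_mod_cast h5
    · show (n₁ : ℝ) ≤ (1 - τ) / hbXi τ - 1
      linarith only [hb', hfl1]
    · show (3 / 2 + τ) / hbXi τ ≤ (n₁ : ℝ) + n₂
      linarith only [hf', hlt1, hlt2]
  exact hun (mem_image.mpr ⟨⟨(n₁, n₂), (P₁, t.2)⟩, mem_sigma.mpr ⟨hnn, mem_product.mpr ⟨hJ1, hJ2⟩⟩,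
    Prod.ext ht1.symm rfl⟩)

end U2PairsB


/-! ## Part C: pattern weights of the unmatched pairs; the Buchstab term -/

section U2PairsC

variable {ι : Type*} (E : Finset ι) (I : ι → Ideal (𝓞 K)) {X τ C₇ C₁ M Err : ℝ}

/-- **Product window at `X^{3/2+τ}`.** For a good chain index of `U^(1)` with
`X^{3/2+τ} ≤ N(P₁P₂) < X^{3/2+τ+2ξ}`, the larger norm lies in `(Y, Y·2X^{2ξ}]` with
`Y = X^{3/2+τ}/(2p₂)`. [cite: HeathBrownActa2001, §7 p. 46] -/
theorem classD2_window (hX : 1 < X) {t : Finset (Ideal (𝓞 K)) × Ideal (𝓞 K)}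
    (ht : t ∈ Upairs X τ 1) (hg : UGood t)
    (hlow : X ^ (3 / 2 + τ) ≤ (Ideal.absNorm (uIdeal t) : ℝ))
    (hd : (Ideal.absNorm (uIdeal t) : ℝ) < X ^ (3 / 2 + τ + 2 * hbXi τ)) :
    ∃ h : ((insert t.2 t.1).image Ideal.absNorm).Nonempty,
      let σ := (insert t.2 t.1).image Ideal.absNorm
      let σ' := σ.erase (σ.max' h)
      let lo : ℝ := X ^ (3 / 2 + τ) / (2 * ∏ p ∈ σ', (p : ℝ))
      0 < lo ∧ lo < (σ.max' h : ℝ) ∧ (σ.max' h : ℝ) ≤ lo * (2 * X ^ ((1 + 1) * hbXi τ)) := by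
  classical
  have hX0 : 0 < X := by linarith
  obtain ⟨hne, hprod, -, -⟩ := pattern_max_min ht hg
  obtain ⟨-, -, hprodN, -⟩ := pattern_props ht hg
  refine ⟨hne, ?_⟩
  set σ := (insert t.2 t.1).image Ideal.absNorm with hσ
  set p₁ := σ.max' hne with hp₁
  set D : ℝ := ∏ p ∈ σ.erase p₁, (p : ℝ) with hD
  have hD0 : 0 < D := by
    rw [hD]; refine prod_pos fun p hp => ?_
    obtain ⟨Q, hQ, rfl⟩ := mem_image.mp (mem_of_mem_erase hp)
    exact_mod_cast (hg.1 Q hQ).pos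
  have hN : (Ideal.absNorm (uIdeal t) : ℝ) = p₁ * D := by
    rw [← hprodN, Nat.cast_prod, hprod]
  simp only
  have hX1τ : 0 < X ^ (3 / 2 + τ) := Real.rpow_pos_of_pos hX0 _
  refine ⟨by positivity, ?_, ?_⟩
  · rw [div_lt_iff₀ (by positivity)]
    rw [hN] at hlow; nlinarith
  · have h1 : X ^ (3 / 2 + τ) / (2 * D) * (2 * X ^ ((1 + 1) * hbXi τ)) =
        X ^ (3 / 2 + τ + 2 * hbXi τ) / D := by
      rw [show (3 / 2 + τ + 2 * hbXi τ : ℝ) = (3 / 2 + τ) + (1 + 1) * hbXi τ by ring,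
        Real.rpow_add hX0 (3 / 2 + τ) ((1 + 1) * hbXi τ)]
      field_simp
    rw [h1, le_div_iff₀ hD0, ← hN]; exact hd.le

open scoped Classical in
/-- **Pattern weight of the unmatched good pairs of `U₂^(1)`** (the four classes of
`U2_unmatched_pair_cases`): with `B = 2(2ξ log X + log 2 + C₁)/(τ log X)`, `w(p) = c_K(p)/p`,
`P0 = {X^τ ≤ p < X^{1−τ}}`, `e_j` its elementary symmetric sums, the total weight is
`≤ 3B·e₁ + (∑_{P0} w)·B·e₀`. [cite: HeathBrownActa2001, §7 pp. 43, 46] -/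
theorem U2_pair_pattern_weight_le (hC₁ : 0 ≤ C₁)
    (hwin : ∀ (lo hi : ℝ) (T : Finset ℕ), 2 ≤ lo → lo ≤ hi →
      (∀ p ∈ T, p.Prime ∧ lo < (p : ℝ) ∧ (p : ℝ) ≤ hi) →
      ∑ p ∈ T, (idealNormCount K p : ℝ) * (p : ℝ)⁻¹ ≤
        Real.log (Real.log hi / Real.log lo) + C₁ / Real.log lo)
    (hX : 1 < X) (hτ : 0 < τ) (hXτ : 4 ≤ X ^ τ) :
    ∑ σ ∈ ((Upairs X τ 1).filter (fun t => UGood t ∧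
          X ^ (3 / 2 + τ) ≤ (Ideal.absNorm (uIdeal t) : ℝ) ∧
          ((∃ Q ∈ insert t.2 t.1, (Ideal.absNorm Q : ℝ) < X ^ (τ + hbXi τ)) ∨
           (∃ Q ∈ insert t.2 t.1, X ^ (1 - τ - hbXi τ) ≤ (Ideal.absNorm Q : ℝ)) ∨
           (∃ Q ∈ insert t.2 t.1, ∃ Q' ∈ insert t.2 t.1, Ideal.absNorm Q < Ideal.absNorm Q' ∧
              (Ideal.absNorm Q' : ℝ) < Ideal.absNorm Q * X ^ hbXi τ) ∨
           ((Ideal.absNorm (uIdeal t) : ℝ) < X ^ (3 / 2 + τ + 2 * hbXi τ))))).image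
          (fun t => (insert t.2 t.1).image Ideal.absNorm),
        ∏ p ∈ σ, (idealNormCount K p : ℝ) * (p : ℝ)⁻¹ ≤
      3 * (2 * (2 * hbXi τ * Real.log X + Real.log 2 + C₁) / (τ * Real.log X)) *
          ∑ σ' ∈ ((range (⌊X ^ (1 - τ)⌋₊ + 1)).filter
              (fun p : ℕ => p.Prime ∧ X ^ τ ≤ (p : ℝ) ∧ (p : ℝ) < X ^ (1 - τ))).powersetCard 1,
            ∏ p ∈ σ', (idealNormCount K p : ℝ) * (p : ℝ)⁻¹ +
      (∑ p ∈ (range (⌊X ^ (1 - τ)⌋₊ + 1)).filter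
          (fun p : ℕ => p.Prime ∧ X ^ τ ≤ (p : ℝ) ∧ (p : ℝ) < X ^ (1 - τ)), (idealNormCount K p : ℝ) * (p : ℝ)⁻¹) *
        (2 * (2 * hbXi τ * Real.log X + Real.log 2 + C₁) / (τ * Real.log X)) *
          ∑ σ' ∈ ((range (⌊X ^ (1 - τ)⌋₊ + 1)).filter
              (fun p : ℕ => p.Prime ∧ X ^ τ ≤ (p : ℝ) ∧ (p : ℝ) < X ^ (1 - τ))).powersetCard 0,
            ∏ p ∈ σ', (idealNormCount K p : ℝ) * (p : ℝ)⁻¹ := by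
  classical
  have hX0 : 0 < X := by linarith
  have hL : 0 < Real.log X := Real.log_pos hX
  have hξ := hbXi_pos hτ
  have hl2 : 0 < Real.log 2 := Real.log_pos one_lt_two
  set P0 := (range (⌊X ^ (1 - τ)⌋₊ + 1)).filter
    (fun p : ℕ => p.Prime ∧ X ^ τ ≤ (p : ℝ) ∧ (p : ℝ) < X ^ (1 - τ)) with hP0
  set w : ℕ → ℝ := fun p => (idealNormCount K p : ℝ) * (p : ℝ)⁻¹ with hw
  set Bw : ℝ := 2 * (2 * hbXi τ * Real.log X + Real.log 2 + C₁) / (τ * Real.log X) with hBw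
  set e1 : ℝ := ∑ σ' ∈ P0.powersetCard 1, ∏ p ∈ σ', w p with he1
  set e0 : ℝ := ∑ σ' ∈ P0.powersetCard 0, ∏ p ∈ σ', w p with he0
  set Lt : ℝ := ∑ p ∈ P0, w p with hLt
  have hP0mem : ∀ p ∈ P0, p.Prime ∧ X ^ τ ≤ (p : ℝ) := fun p hp =>
    ⟨(mem_P0_iff.mp hp).1, (mem_P0_iff.mp hp).2.1⟩
  have he10 : 0 ≤ e1 := esymm_nonneg P0 w (normWt_nonneg_on P0) _
  have he00 : 0 ≤ e0 := esymm_nonneg P0 w (normWt_nonneg_on P0) _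
  have hLt0 : 0 ≤ Lt := sum_nonneg (normWt_nonneg_on P0)
  have hτL : 0 < τ * Real.log X := by positivity
  have hBw0 : 0 ≤ Bw := by rw [hBw]; positivity
  -- the four sub-families
  set hbigP := fun t : Finset (Ideal (𝓞 K)) × Ideal (𝓞 K) =>
    X ^ (3 / 2 + τ) ≤ (Ideal.absNorm (uIdeal t) : ℝ) with hhbigP
  set ca := fun t : Finset (Ideal (𝓞 K)) × Ideal (𝓞 K) =>
    ∃ Q ∈ insert t.2 t.1, (Ideal.absNorm Q : ℝ) < X ^ (τ + hbXi τ) with hca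
  set cb := fun t : Finset (Ideal (𝓞 K)) × Ideal (𝓞 K) =>
    ∃ Q ∈ insert t.2 t.1, X ^ (1 - τ - hbXi τ) ≤ (Ideal.absNorm Q : ℝ) with hcb
  set ce := fun t : Finset (Ideal (𝓞 K)) × Ideal (𝓞 K) =>
    ∃ Q ∈ insert t.2 t.1, ∃ Q' ∈ insert t.2 t.1, Ideal.absNorm Q < Ideal.absNorm Q' ∧
      (Ideal.absNorm Q' : ℝ) < Ideal.absNorm Q * X ^ hbXi τ with hce
  set cf := fun t : Finset (Ideal (𝓞 K)) × Ideal (𝓞 K) =>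
    (Ideal.absNorm (uIdeal t) : ℝ) < X ^ (3 / 2 + τ + 2 * hbXi τ) with hcf
  set pat := fun t : Finset (Ideal (𝓞 K)) × Ideal (𝓞 K) => (insert t.2 t.1).image Ideal.absNorm with hpat
  set U := Upairs X τ 1 with hU
  set Ta := U.filter (fun t => UGood t ∧ hbigP t ∧ ca t) with hTa
  set Tb := U.filter (fun t => UGood t ∧ hbigP t ∧ cb t) with hTb
  set Te := U.filter (fun t => UGood t ∧ hbigP t ∧ ce t) with hTe
  set Tf := U.filter (fun t => UGood t ∧ hbigP t ∧ cf t) with hTf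
  have hgoodTa : ∀ t ∈ Ta, t ∈ Upairs X τ 1 ∧ UGood t := fun t ht =>
    ⟨(mem_filter.mp ht).1, (mem_filter.mp ht).2.1⟩
  have hgoodTb : ∀ t ∈ Tb, t ∈ Upairs X τ 1 ∧ UGood t := fun t ht =>
    ⟨(mem_filter.mp ht).1, (mem_filter.mp ht).2.1⟩
  have hgoodTe : ∀ t ∈ Te, t ∈ Upairs X τ 1 ∧ UGood t := fun t ht =>
    ⟨(mem_filter.mp ht).1, (mem_filter.mp ht).2.1⟩
  have hgoodTf : ∀ t ∈ Tf, t ∈ Upairs X τ 1 ∧ UGood t := fun t ht =>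
    ⟨(mem_filter.mp ht).1, (mem_filter.mp ht).2.1⟩
  have hcover : (U.filter (fun t => UGood t ∧ hbigP t ∧ (ca t ∨ cb t ∨ ce t ∨ cf t))).image pat ⊆
      Ta.image pat ∪ Tb.image pat ∪ Te.image pat ∪ Tf.image pat := by
    intro σ hσ
    obtain ⟨t, ht, rfl⟩ := mem_image.mp hσ
    obtain ⟨htU, hg, hb, hcls⟩ := mem_filter.mp ht
    simp only [mem_union]
    rcases hcls with h | h | h | h
    · exact Or.inl (Or.inl (Or.inl (mem_image_of_mem _ (mem_filter.mpr ⟨htU, hg, hb, h⟩))))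
    · exact Or.inl (Or.inl (Or.inr (mem_image_of_mem _ (mem_filter.mpr ⟨htU, hg, hb, h⟩))))
    · exact Or.inl (Or.inr (mem_image_of_mem _ (mem_filter.mpr ⟨htU, hg, hb, h⟩)))
    · exact Or.inr (mem_image_of_mem _ (mem_filter.mpr ⟨htU, hg, hb, h⟩))
  have hf0 : ∀ σ : Finset ℕ, 0 ≤ ∏ p ∈ σ, w p := fun σ => prod_nonneg fun p _ => normWt_nonneg p
  -- window weights
  have hWa : ∑ p ∈ P0.filter (fun p : ℕ => (p : ℝ) < X ^ (τ + hbXi τ)), w p ≤ Bw := by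
    have hlo : 0 < X ^ τ / 2 := by positivity
    have h := floating_window_normWt_le hC₁ hwin hX hτ hXτ hlo
      (show X ^ τ / 2 ≤ X ^ (τ + hbXi τ) by
        have : X ^ τ ≤ X ^ (τ + hbXi τ) := Real.rpow_le_rpow_of_exponent_le hX.le (by linarith)
        linarith)
      (P0.filter fun p : ℕ => (p : ℝ) < X ^ (τ + hbXi τ)) (fun p hp => by
        rw [mem_filter] at hp
        exact ⟨(hP0mem p hp.1).1, (hP0mem p hp.1).2, by linarith [(hP0mem p hp.1).2], hp.2.le⟩)
    have hratio : Real.log (X ^ (τ + hbXi τ) / (X ^ τ / 2)) = hbXi τ * Real.log X + Real.log 2 := by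
      rw [div_div_eq_mul_div, Real.log_div (by positivity) (by positivity), Real.log_mul (by positivity) two_ne_zero,
        Real.log_rpow hX0, Real.log_rpow hX0]; ring
    rw [hratio] at h
    refine h.trans ?_
    rw [hBw]
    refine div_le_div_of_nonneg_right ?_ hτL.le
    nlinarith [mul_nonneg hξ.le hL.le]
  have hWb : ∑ p ∈ P0.filter (fun p : ℕ => X ^ (1 - τ - hbXi τ) ≤ (p : ℝ)), w p ≤ Bw := by
    have hlo : 0 < X ^ (1 - τ - hbXi τ) / 2 := by positivity
    have h := floating_window_normWt_le hC₁ hwin hX hτ hXτ hlo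
      (show X ^ (1 - τ - hbXi τ) / 2 ≤ X ^ (1 - τ) by
        have : X ^ (1 - τ - hbXi τ) ≤ X ^ (1 - τ) := Real.rpow_le_rpow_of_exponent_le hX.le (by linarith)
        linarith [Real.rpow_nonneg hX0.le (1 - τ - hbXi τ)])
      (P0.filter fun p : ℕ => X ^ (1 - τ - hbXi τ) ≤ (p : ℝ)) (fun p hp => by
        rw [mem_filter] at hp
        exact ⟨(hP0mem p hp.1).1, (hP0mem p hp.1).2, by linarith [hp.2], (mem_P0_iff.mp hp.1).2.2.le⟩)
    have hratio : Real.log (X ^ (1 - τ) / (X ^ (1 - τ - hbXi τ) / 2)) = hbXi τ * Real.log X + Real.log 2 := by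
      rw [div_div_eq_mul_div, Real.log_div (by positivity) (by positivity), Real.log_mul (by positivity) two_ne_zero,
        Real.log_rpow hX0, Real.log_rpow hX0]; ring
    rw [hratio] at h
    refine h.trans ?_
    rw [hBw]
    refine div_le_div_of_nonneg_right ?_ hτL.le
    nlinarith [mul_nonneg hξ.le hL.le]
  -- (a), (b)
  have hA : ∑ σ ∈ Ta.image pat, ∏ p ∈ σ, w p ≤ Bw * e1 :=
    sum_class_window_le P0 _ (image_pattern_subset (n := 1) Ta hgoodTa) (fun p : ℕ => (p : ℝ) < X ^ (τ + hbXi τ))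
      (fun σ hσ => by
        obtain ⟨t, ht, rfl⟩ := mem_image.mp hσ
        obtain ⟨Q, hQ, hQlt⟩ := (mem_filter.mp ht).2.2.2
        exact ⟨Ideal.absNorm Q, mem_image_of_mem _ hQ, hQlt⟩) hWa
  have hB : ∑ σ ∈ Tb.image pat, ∏ p ∈ σ, w p ≤ Bw * e1 :=
    sum_class_window_le P0 _ (image_pattern_subset (n := 1) Tb hgoodTb) (fun p : ℕ => X ^ (1 - τ - hbXi τ) ≤ (p : ℝ))
      (fun σ hσ => by
        obtain ⟨t, ht, rfl⟩ := mem_image.mp hσ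
        obtain ⟨Q, hQ, hQle⟩ := (mem_filter.mp ht).2.2.2
        exact ⟨Ideal.absNorm Q, mem_image_of_mem _ hQ, hQle⟩) hWb
  -- (f): product window
  have hρf : (1 : ℝ) ≤ 2 * X ^ ((1 + 1) * hbXi τ) := by
    have := Real.one_le_rpow hX.le (show 0 ≤ (1 + 1) * hbXi τ by positivity); linarith
  have hF : ∑ σ ∈ Tf.image pat, ∏ p ∈ σ, w p ≤ Bw * e1 := by
    have h := sum_class_floating_le P0 hC₁ hwin hX hτ hXτ hP0mem _ (image_pattern_subset (n := 1) Tf hgoodTf)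
      (fun σ' => X ^ (3 / 2 + τ) / (2 * ∏ p ∈ σ', (p : ℝ))) hρf
      (fun σ hσ => by
        obtain ⟨t, ht, rfl⟩ := mem_image.mp hσ
        obtain ⟨htU, hg, hbg, hf⟩ := mem_filter.mp ht
        exact classD2_window hX htU hg hbg hf)
    refine h.trans (mul_le_mul_of_nonneg_right (le_of_eq ?_) he10)
    rw [Real.log_mul two_ne_zero (by positivity), Real.log_rpow hX0, hBw]
    ring
  -- (e): close pair
  have hρe : (1 : ℝ) ≤ X ^ hbXi τ := Real.one_le_rpow hX.le hξ.le
  have hE : ∑ σ ∈ Te.image pat, ∏ p ∈ σ, w p ≤ Lt * Bw * e0 := by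
    have h := sum_class_close_le P0 hC₁ hwin hX hτ hXτ hP0mem _ (image_pattern_subset (n := 1) Te hgoodTe) hρe
      (fun σ hσ => by
        obtain ⟨t, ht, rfl⟩ := mem_image.mp hσ
        obtain ⟨Q, hQ, Q', hQ', hlt, hclose⟩ := (mem_filter.mp ht).2.2.2
        exact ⟨Ideal.absNorm Q, mem_image_of_mem _ hQ, Ideal.absNorm Q', mem_image_of_mem _ hQ', hlt, hclose.le⟩)
    refine h.trans (mul_le_mul_of_nonneg_right (mul_le_mul_of_nonneg_left ?_ hLt0) he00)
    rw [Real.log_rpow hX0, hBw]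
    refine div_le_div_of_nonneg_right ?_ hτL.le
    nlinarith [mul_nonneg hξ.le hL.le, hl2.le]
  -- combine
  show ∑ σ ∈ (U.filter (fun t => UGood t ∧ hbigP t ∧ (ca t ∨ cb t ∨ ce t ∨ cf t))).image pat,
      ∏ p ∈ σ, w p ≤ 3 * Bw * e1 + Lt * Bw * e0
  calc ∑ σ ∈ (U.filter (fun t => UGood t ∧ hbigP t ∧ (ca t ∨ cb t ∨ ce t ∨ cf t))).image pat, ∏ p ∈ σ, w p
      ≤ ∑ σ ∈ Ta.image pat ∪ Tb.image pat ∪ Te.image pat ∪ Tf.image pat, ∏ p ∈ σ, w p :=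
        sum_le_sum_of_subset_of_nonneg hcover fun σ _ _ => hf0 σ
    _ ≤ ∑ σ ∈ Ta.image pat, ∏ p ∈ σ, w p + ∑ σ ∈ Tb.image pat, ∏ p ∈ σ, w p +
          ∑ σ ∈ Te.image pat, ∏ p ∈ σ, w p + ∑ σ ∈ Tf.image pat, ∏ p ∈ σ, w p := by
        have s3 := sum_union_le_add (Ta.image pat ∪ Tb.image pat ∪ Te.image pat) (Tf.image pat) hf0
        have s4 := sum_union_le_add (Ta.image pat ∪ Tb.image pat) (Te.image pat) hf0
        have s5 := sum_union_le_add (Ta.image pat) (Tb.image pat) hf0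
        linarith
    _ ≤ Bw * e1 + Bw * e1 + Lt * Bw * e0 + Bw * e1 := by linarith [hA, hB, hE, hF]
    _ = 3 * Bw * e1 + Lt * Bw * e0 := by ring

end U2PairsC


/-! ## Part D: the unmatched pairs summed; the Buchstab term through close pairs -/

section U2PairsD

variable {ι : Type*} (E : Finset ι) (I : ι → Ideal (𝓞 K)) {X τ C₇ C₁ M Err CN : ℝ}

open scoped Classical in
/-- **The unmatched pairs of `U₂^(1)` summed**: non-good pairs contribute at most `#𝒵_{P₁P₂}`
(raw, family-dependent), good ones — in the four classes — through Lemma 7.1 at level `X^τ` on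
`[2, X^{2−2τ})` with the pattern weight `3B e₁ + L_t B e₀`. [cite: HeathBrownActa2001, §7 p. 46] -/
theorem U2_unmatched_sum_le (hC₁ : 0 ≤ C₁)
    (hwin : ∀ (lo hi : ℝ) (T : Finset ℕ), 2 ≤ lo → lo ≤ hi →
      (∀ p ∈ T, p.Prime ∧ lo < (p : ℝ) ∧ (p : ℝ) ≤ hi) →
      ∑ p ∈ T, (idealNormCount K p : ℝ) * (p : ℝ)⁻¹ ≤
        Real.log (Real.log hi / Real.log lo) + C₁ / Real.log lo)
    (hX : (2 : ℝ) ^ 15 ≤ X) (hτ : 0 < τ) (hτ1 : τ ≤ 1 / 8) (hXτ : 4 ≤ X ^ τ)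
    (hC₇ : 0 ≤ C₇) (hM : 0 ≤ M) (hErr : 0 ≤ Err)
    (h7 : ∀ (N z : ℝ) (𝒬 : Finset ℕ), X ^ τ ≤ z → 0 < N → N ≤ X ^ (2 - 2 * τ) →
        (∀ q ∈ 𝒬, Squarefree q ∧ N < q ∧ (q : ℝ) ≤ 2 * N) →
        ∑ Q ∈ normIn 𝒬, (famSifted E I Q z : ℝ) ≤
          C₇ * (M / Real.log (min z (X ^ (2 - τ) / N)) *
            ∑ Q ∈ normIn 𝒬, ((Ideal.absNorm Q : ℕ) : ℝ)⁻¹ + Err)) :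
    ∑ t ∈ ((Upairs X τ 1).filter (fun t => X ^ (3 / 2 + τ) ≤ (Ideal.absNorm (uIdeal t) : ℝ))).filter
        (fun t => t ∉ ((nPairs τ).sigma (fun nn => Jprimes X τ nn.1 ×ˢ Jprimes X τ nn.2)).image
          (fun a : (Σ _ : ℕ × ℕ, Ideal (𝓞 K) × Ideal (𝓞 K)) =>
            ((({a.2.1} : Finset (Ideal (𝓞 K))), a.2.2) : Finset (Ideal (𝓞 K)) × Ideal (𝓞 K)))),
        (famSiftedAbove E I (uIdeal t) t.2 : ℝ) ≤
      ∑ t ∈ (Upairs X τ 1).filter (fun t => ¬ UGood t), (famCount E I (uIdeal t) : ℝ) +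
      (C₇ * (M / (τ * Real.log X)) *
        (3 * (2 * (2 * hbXi τ * Real.log X + Real.log 2 + C₁) / (τ * Real.log X)) *
            ∑ σ' ∈ ((range (⌊X ^ (1 - τ)⌋₊ + 1)).filter
                (fun p : ℕ => p.Prime ∧ X ^ τ ≤ (p : ℝ) ∧ (p : ℝ) < X ^ (1 - τ))).powersetCard 1,
              ∏ p ∈ σ', (idealNormCount K p : ℝ) * (p : ℝ)⁻¹ +
        (∑ p ∈ (range (⌊X ^ (1 - τ)⌋₊ + 1)).filter
            (fun p : ℕ => p.Prime ∧ X ^ τ ≤ (p : ℝ) ∧ (p : ℝ) < X ^ (1 - τ)), (idealNormCount K p : ℝ) * (p : ℝ)⁻¹) *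
          (2 * (2 * hbXi τ * Real.log X + Real.log 2 + C₁) / (τ * Real.log X)) *
            ∑ σ' ∈ ((range (⌊X ^ (1 - τ)⌋₊ + 1)).filter
                (fun p : ℕ => p.Prime ∧ X ^ τ ≤ (p : ℝ) ∧ (p : ℝ) < X ^ (1 - τ))).powersetCard 0,
              ∏ p ∈ σ', (idealNormCount K p : ℝ) * (p : ℝ)⁻¹) +
        3 * Real.log X * (C₇ * Err)) := by
  classical
  have hX1 : 1 < X := lt_of_lt_of_le (by norm_num) hX
  have hX0 : 0 < X := by linarith
  set R₂ := (Upairs X τ 1).filter (fun t => X ^ (3 / 2 + τ) ≤ (Ideal.absNorm (uIdeal t) : ℝ)) with hR₂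
  set A₁ := (nPairs τ).sigma (fun nn => Jprimes X τ nn.1 ×ˢ Jprimes X τ nn.2) with hA₁
  set φ : (Σ _ : ℕ × ℕ, Ideal (𝓞 K) × Ideal (𝓞 K)) → Finset (Ideal (𝓞 K)) × Ideal (𝓞 K) :=
    fun a => ((({a.2.1} : Finset (Ideal (𝓞 K))), a.2.2)) with hφ
  set unm := R₂.filter (fun t => t ∉ A₁.image φ) with hunm
  set Tg := unm.filter (fun t => UGood t) with hTg
  set Tb := (Upairs X τ 1).filter (fun t => ¬ UGood t) with hTb
  have hsplit : unm ⊆ Tb ∪ Tg := by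
    intro t ht
    by_cases hg : UGood t
    · exact mem_union_right _ (mem_filter.mpr ⟨ht, hg⟩)
    · exact mem_union_left _ (mem_filter.mpr ⟨(mem_filter.mp (mem_filter.mp ht).1).1, hg⟩)
  have hF0 : ∀ t : Finset (Ideal (𝓞 K)) × Ideal (𝓞 K), 0 ≤ (famSiftedAbove E I (uIdeal t) t.2 : ℝ) :=
    fun _ => Nat.cast_nonneg _
  refine (sum_le_sum_of_subset_of_nonneg hsplit fun t _ _ => hF0 t).trans ?_
  refine (sum_union_le_add Tb Tg hF0).trans (add_le_add ?_ ?_)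
  · -- non-good pairs: `F ≤ #𝒵`
    exact sum_le_sum fun t _ => by
      exact_mod_cast (famSiftedAbove_le_famSifted E I _ _ le_rfl).trans (famSifted_le_famCount E I _ _)
  · -- good pairs: Lemma 7.1
    have hTg : ∀ t ∈ Tg, t ∈ Upairs X τ 1 ∧ UGood t ∧ X ^ (3 / 2 + τ) ≤ (Ideal.absNorm (uIdeal t) : ℝ) ∧
        t ∉ A₁.image φ := by
      intro t ht
      obtain ⟨ht1, hg⟩ := mem_filter.mp ht
      obtain ⟨ht2, hun⟩ := mem_filter.mp ht1
      obtain ⟨htU, hbig⟩ := mem_filter.mp ht2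
      exact ⟨htU, hg, hbig, hun⟩
    -- `F ≤ S_K(·, X^τ)`
    have hstep0 : ∑ t ∈ Tg, (famSiftedAbove E I (uIdeal t) t.2 : ℝ) ≤
        ∑ t ∈ Tg, (famSifted E I (uIdeal t) (X ^ τ) : ℝ) := by
      refine sum_le_sum fun t ht => ?_
      have hz : X ^ τ ≤ (Ideal.absNorm t.2 : ℝ) :=
        (mem_smallPrimes_iff.mp (mem_Upairs_iff.mp (hTg t ht).1).2.1).2.2.1
      exact_mod_cast famSiftedAbove_le_famSifted E I _ _ hz
    refine hstep0.trans ?_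
    -- re-index by the ideal and apply Lemma 7.1 on `[2, X^{2-2τ})`
    have hinj : Set.InjOn uIdeal (Tg : Set _) := (uIdeal_injOn X τ 1).mono fun t ht => (hTg t ht).1
    rw [← sum_image (f := fun Q => (famSifted E I Q (X ^ τ) : ℝ)) hinj]
    have hTimg : ∀ Q ∈ Tg.image uIdeal, Squarefree (Ideal.absNorm Q) ∧ (2 : ℝ) ≤ (Ideal.absNorm Q : ℝ) ∧
        (Ideal.absNorm Q : ℝ) < X ^ (2 - 2 * τ) := by
      intro Q hQ
      obtain ⟨t, ht, rfl⟩ := mem_image.mp hQ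
      obtain ⟨htU, hg, hbig, -⟩ := hTg t ht
      obtain ⟨P₁, -, hsm1, hsm2, -, -, -, -, hu⟩ := chain1_props htU hg
      refine ⟨squarefree_absNorm_uIdeal (snd_notMem_fst htU) hg, ?_, ?_⟩
      · have : (2 : ℝ) ≤ X ^ (3 / 2 + τ) := by
          have h1 : X ^ τ ≤ X ^ (3 / 2 + τ) := Real.rpow_le_rpow_of_exponent_le hX1.le (by linarith)
          linarith
        exact this.trans hbig
      · rw [hu, map_mul, Nat.cast_mul]
        have h1 := (mem_smallPrimes_iff.mp hsm1).2.2.2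
        have h2 := (mem_smallPrimes_iff.mp hsm2).2.2.2
        calc (Ideal.absNorm P₁ : ℝ) * Ideal.absNorm t.2 < X ^ (1 - τ) * X ^ (1 - τ) :=
              mul_lt_mul'' h1 h2 (Nat.cast_nonneg _) (Nat.cast_nonneg _)
          _ = X ^ (2 - 2 * τ) := by rw [← Real.rpow_add hX0]; ring_nf
    have step2 := sum_sifted_le_of_h7 E I hX hτ hτ1 hC₇ hM hErr h7 (Tg.image uIdeal) hTimg
    refine step2.trans (add_le_add (mul_le_mul_of_nonneg_left ?_
      (mul_nonneg hC₇ (div_nonneg hM (mul_nonneg hτ.le (Real.log_nonneg hX1.le))))) le_rfl)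
    -- weights through patterns, then the four classes
    have hTg' : ∀ t ∈ Tg, t ∈ Upairs X τ 1 ∧ UGood t := fun t ht => ⟨(hTg t ht).1, (hTg t ht).2.1⟩
    have step3 : ∑ q ∈ (Tg.image uIdeal).image Ideal.absNorm, (idealNormCount K q : ℝ) * (q : ℝ)⁻¹ ≤
        ∑ σ ∈ Tg.image (fun t => (insert t.2 t.1).image Ideal.absNorm),
          ∏ p ∈ σ, (idealNormCount K p : ℝ) * (p : ℝ)⁻¹ := by
      rw [image_image]
      exact sum_image_absNorm_uIdeal_le Tg hTg'
    refine step3.trans ?_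
    have hsub : Tg.image (fun t => (insert t.2 t.1).image Ideal.absNorm) ⊆
        ((Upairs X τ 1).filter (fun t => UGood t ∧
          X ^ (3 / 2 + τ) ≤ (Ideal.absNorm (uIdeal t) : ℝ) ∧
          ((∃ Q ∈ insert t.2 t.1, (Ideal.absNorm Q : ℝ) < X ^ (τ + hbXi τ)) ∨
           (∃ Q ∈ insert t.2 t.1, X ^ (1 - τ - hbXi τ) ≤ (Ideal.absNorm Q : ℝ)) ∨
           (∃ Q ∈ insert t.2 t.1, ∃ Q' ∈ insert t.2 t.1, Ideal.absNorm Q < Ideal.absNorm Q' ∧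
              (Ideal.absNorm Q' : ℝ) < Ideal.absNorm Q * X ^ hbXi τ) ∨
           ((Ideal.absNorm (uIdeal t) : ℝ) < X ^ (3 / 2 + τ + 2 * hbXi τ))))).image
          (fun t => (insert t.2 t.1).image Ideal.absNorm) := by
      refine image_subset_image fun t ht => ?_
      obtain ⟨htU, hg, hbig, hun⟩ := hTg t ht
      exact mem_filter.mpr ⟨htU, hg, hbig, U2_unmatched_pair_cases hX1 hτ htU hg hun⟩
    exact (sum_le_sum_of_subset_of_nonneg hsub fun σ _ _ => prod_nonneg fun p _ => normWt_nonneg p).trans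
      (U2_pair_pattern_weight_le hC₁ hwin hX1 hτ hXτ)

variable {E I}

/-- **At most three prime factors of norm `> X^{3/4+τ/2}`** for an ideal of norm `≤ C_N X³`,
`C_N ≤ X^{2τ}` (`X > 1`): four of them would have product norm `> X^{3+2τ}`. [folklore] -/
theorem card_largePrimes_dvd_le_three (hX : 1 < X) {J : Ideal (𝓞 K)} (hJ0 : J ≠ ⊥)
    (hCN : CN ≤ X ^ (2 * τ)) (hJ : (Ideal.absNorm J : ℝ) ≤ CN * X ^ 3) (S : Finset (Ideal (𝓞 K)))
    (hS : ∀ P ∈ S, P.IsPrime ∧ P ∣ J ∧ X ^ (3 / 4 + τ / 2) < (Ideal.absNorm P : ℝ)) : #S ≤ 3 := by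
  classical
  have hX0 : 0 < X := by linarith
  by_contra h
  push Not at h
  -- take four of them
  obtain ⟨S4, hS4, hcard⟩ := exists_subset_card_eq (show 4 ≤ #S by omega)
  have hprime : ∀ P ∈ S4, Prime P := fun P hP => by
    have h1 := hS P (hS4 hP)
    have hP0 : P ≠ ⊥ := by
      rintro rfl
      exact hJ0 (Ideal.dvd_iff_le.mp h1.2.1 |>.antisymm bot_le ▸ rfl)
    exact Ideal.prime_of_isPrime hP0 h1.1
  have hdiv : ∀ P ∈ S4, P ∣ J := fun P hP => (hS P (hS4 hP)).2.1
  have hprod : ∏ P ∈ S4, P ∣ J := Finset.prod_primes_dvd J hprime hdiv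
  have hNJ0 : 0 < Ideal.absNorm J := Nat.pos_of_ne_zero fun h => hJ0 (Ideal.absNorm_eq_zero_iff.mp h)
  have hle : (Ideal.absNorm (∏ P ∈ S4, P) : ℝ) ≤ CN * X ^ 3 :=
    le_trans (by exact_mod_cast Nat.le_of_dvd hNJ0 (map_dvd Ideal.absNorm hprod)) hJ
  have hz0 : 0 < X ^ (3 / 4 + τ / 2) := Real.rpow_pos_of_pos hX0 _
  have hge : (X ^ (3 / 4 + τ / 2)) ^ 4 < (Ideal.absNorm (∏ P ∈ S4, P) : ℝ) := by
    rw [map_prod, Nat.cast_prod, ← hcard, ← prod_const]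
    exact prod_lt_prod_of_nonempty (fun _ _ => hz0) (fun P hP => (hS P (hS4 hP)).2.2)
      (card_pos.mp (by omega))
  have hX4 : (X ^ (3 / 4 + τ / 2)) ^ 4 = X ^ (2 * τ) * X ^ 3 := by
    rw [← Real.rpow_natCast, ← Real.rpow_mul hX0.le,
      show (3 / 4 + τ / 2) * ((4 : ℕ) : ℝ) = 2 * τ + (3 : ℕ) by push_cast; ring,
      Real.rpow_add hX0, Real.rpow_natCast]
  rw [hX4] at hge
  have : CN * X ^ 3 < X ^ (2 * τ) * X ^ 3 := lt_of_le_of_lt' (le_refl _) (by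
    have hX3 : 0 < X ^ 3 := pow_pos hX0 3
    nlinarith [hle, hge, mul_le_mul_of_nonneg_right hCN hX3.le])
  have hX3 : 0 < X ^ 3 := pow_pos hX0 3
  nlinarith [mul_le_mul_of_nonneg_right hCN hX3.le]

/-- A product of two nonzero primes `P·Q` with `N(Q) < N(P)` determines the pair. [folklore] -/
theorem pair_eq_of_mul_eq {P Q P' Q' : Ideal (𝓞 K)} (hP : P.IsPrime) (hP0 : P ≠ ⊥) (hQ : Q.IsPrime)
    (hQ0 : Q ≠ ⊥) (hP' : P'.IsPrime) (hP'0 : P' ≠ ⊥) (hQ' : Q'.IsPrime) (hQ'0 : Q' ≠ ⊥)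
    (hlt : Ideal.absNorm Q < Ideal.absNorm P) (hlt' : Ideal.absNorm Q' < Ideal.absNorm P')
    (h : P * Q = P' * Q') : P = P' ∧ Q = Q' := by
  have hmaxP : P.IsMaximal := Ring.DimensionLEOne.maximalOfPrime hP0 hP
  have hmaxQ : Q.IsMaximal := Ring.DimensionLEOne.maximalOfPrime hQ0 hQ
  have hmaxP' : P'.IsMaximal := Ring.DimensionLEOne.maximalOfPrime hP'0 hP'
  have hmaxQ' : Q'.IsMaximal := Ring.DimensionLEOne.maximalOfPrime hQ'0 hQ'
  have hprP : Prime P := Ideal.prime_of_isPrime hP0 hP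
  have hprP' : Prime P' := Ideal.prime_of_isPrime hP'0 hP'
  -- `P ∣ P'Q'`
  have hPdvd : P ∣ P' * Q' := ⟨Q, by rw [← h]⟩
  have hPP' : P = P' := by
    rcases hprP.dvd_or_dvd hPdvd with h1 | h1
    · exact (hmaxP'.eq_of_le hP.ne_top (Ideal.dvd_iff_le.mp h1)).symm
    · -- `P = Q'`, then `P' ∣ PQ` forces `P' = Q`, contradicting the norm ordering
      have hPQ' : P = Q' := (hmaxQ'.eq_of_le hP.ne_top (Ideal.dvd_iff_le.mp h1)).symm
      have hP'dvd : P' ∣ P * Q := ⟨Q', h⟩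
      rcases hprP'.dvd_or_dvd hP'dvd with h2 | h2
      · exact ((hmaxP.eq_of_le hP'.ne_top (Ideal.dvd_iff_le.mp h2)).symm).symm
      · have hP'Q : P' = Q := (hmaxQ.eq_of_le hP'.ne_top (Ideal.dvd_iff_le.mp h2)).symm
        rw [hPQ'] at hlt; rw [hP'Q] at hlt'
        omega
  refine ⟨hPP', ?_⟩
  rw [hPP'] at h
  exact mul_left_cancel₀ hP'0 h

end U2PairsD


/-! ## Part E: the Buchstab term through close pairs `(P₂, Q)` -/

section U2PairsE

variable {ι : Type*} (E : Finset ι) (I : ι → Ideal (𝓞 K)) {X τ CN : ℝ}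

open scoped Classical in
/-- **The Buchstab range of `U₂^(1)` through close pairs** (p. 47: "all the errors … can still be
estimated via Lemma 7.1, in view of the bound `#{P₂ : P₁P₂ ∈ 𝒜_{Q₁⋯Q_{n+1}}} ≤ 1`"): a member of
`𝒵_{P₁P₂}` which is `X^{n₂ξ}`-rough but has a prime factor `Q ≺ P₂` with `N(Q) ≥ X^{n₂ξ}` of prime
norm `≠ N(P₂)` is divisible by the close pair `P₂Q`; since at most three prime factors of a member
exceed `X^{3/4+τ/2} < N(P₁)`, the total over the pair indices is at most
`3 ∑_{(P₂,Q)} S_K(𝒵_{P₂Q}, X^τ)`. [cite: HeathBrownActa2001, §7 pp. 46–47] -/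
theorem U2_buchstab_good_le (hX : 1 < X) (hτ : 0 < τ) (hτ1 : τ ≤ 1 / 4) (hCN : CN ≤ X ^ (2 * τ))
    (hE : ∀ i ∈ E, I i ≠ ⊥ ∧ (Ideal.absNorm (I i) : ℝ) ≤ CN * X ^ 3) :
    ∑ a ∈ (nPairs τ).sigma (fun nn => Jprimes X τ nn.1 ×ˢ Jprimes X τ nn.2),
      ∑ Q ∈ ((idealsLE (Ideal.absNorm a.2.2)).filter
          (fun Q => Q.IsPrime ∧ Q ≠ ⊥ ∧ X ^ ((a.1.2 : ℝ) * hbXi τ) ≤ (Ideal.absNorm Q : ℝ) ∧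
            PrimeLT Q a.2.2)).filter
          (fun Q => (Ideal.absNorm Q).Prime ∧ Ideal.absNorm Q ≠ Ideal.absNorm a.2.2),
        (#{i ∈ E | a.2.1 * a.2.2 ∣ I i ∧ Q ∣ I i ∧ IsRough (X ^ ((a.1.2 : ℝ) * hbXi τ)) (I i)} : ℝ) ≤
      3 * ∑ d ∈ ((nPairs τ).sigma (fun nn => Jprimes X τ nn.1 ×ˢ Jprimes X τ nn.2)).biUnion
          (fun a => (((idealsLE (Ideal.absNorm a.2.2)).filter
            (fun Q => Q.IsPrime ∧ Q ≠ ⊥ ∧ X ^ ((a.1.2 : ℝ) * hbXi τ) ≤ (Ideal.absNorm Q : ℝ) ∧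
              PrimeLT Q a.2.2)).filter
            (fun Q => (Ideal.absNorm Q).Prime ∧ Ideal.absNorm Q ≠ Ideal.absNorm a.2.2)).image
            (fun Q => (a.2.2, Q))),
        (famSifted E I (d.1 * d.2) (X ^ τ) : ℝ) := by
  classical
  have hX0 : 0 < X := by linarith
  have hξ := hbXi_pos hτ
  set A₁ := (nPairs τ).sigma (fun nn => Jprimes X τ nn.1 ×ˢ Jprimes X τ nn.2) with hA₁
  set Bs : (Σ _ : ℕ × ℕ, Ideal (𝓞 K) × Ideal (𝓞 K)) → Finset (Ideal (𝓞 K)) := fun a =>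
    ((idealsLE (Ideal.absNorm a.2.2)).filter
      (fun Q => Q.IsPrime ∧ Q ≠ ⊥ ∧ X ^ ((a.1.2 : ℝ) * hbXi τ) ≤ (Ideal.absNorm Q : ℝ) ∧
        PrimeLT Q a.2.2)).filter
      (fun Q => (Ideal.absNorm Q).Prime ∧ Ideal.absNorm Q ≠ Ideal.absNorm a.2.2) with hBs
  set D := A₁.biUnion (fun a => (Bs a).image (fun Q => (a.2.2, Q))) with hD
  change ∑ a ∈ A₁, ∑ Q ∈ Bs a,
      (#{i ∈ E | a.2.1 * a.2.2 ∣ I i ∧ Q ∣ I i ∧ IsRough (X ^ ((a.1.2 : ℝ) * hbXi τ)) (I i)} : ℝ) ≤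
    3 * ∑ d ∈ D, (famSifted E I (d.1 * d.2) (X ^ τ) : ℝ)
  -- facts about the indices
  have hBmem : ∀ a ∈ A₁, ∀ Q ∈ Bs a, Q.IsPrime ∧ Q ≠ ⊥ ∧ X ^ ((a.1.2 : ℝ) * hbXi τ) ≤ (Ideal.absNorm Q : ℝ) ∧
      PrimeLT Q a.2.2 ∧ (Ideal.absNorm Q).Prime ∧ Ideal.absNorm Q ≠ Ideal.absNorm a.2.2 := by
    intro a _ Q hQ
    simp only [hBs, mem_filter] at hQ
    exact ⟨hQ.1.2.1, hQ.1.2.2.1, hQ.1.2.2.2.1, hQ.1.2.2.2.2, hQ.2.1, hQ.2.2⟩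
  -- pointwise: `P₂Q ∣ I_i`, `X^τ`-rough, and `P₁ ∣ I_i`
  set cond : (Σ a : (Σ _ : ℕ × ℕ, Ideal (𝓞 K) × Ideal (𝓞 K)), Ideal (𝓞 K)) → ι → Prop := fun x i =>
    x.1.2.2 * x.2 ∣ I i ∧ IsRough (X ^ τ) (I i) ∧ x.1.2.1 ∣ I i with hcond
  have hpt : ∀ a ∈ A₁, ∀ Q ∈ Bs a,
      (#{i ∈ E | a.2.1 * a.2.2 ∣ I i ∧ Q ∣ I i ∧ IsRough (X ^ ((a.1.2 : ℝ) * hbXi τ)) (I i)} : ℝ) ≤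
        #{i ∈ E | cond ⟨a, Q⟩ i} := by
    intro a ha Q hQ
    obtain ⟨-, ⟨h2p, h20, -, -, -⟩, hzτ, -⟩ := pairIndex_props hX hτ hτ1 ha
    obtain ⟨hQp, hQ0, -, -, -, hNne⟩ := hBmem a ha Q hQ
    have hQP₂ : ¬ Q ∣ a.2.2 := fun h => by
      have hmax : a.2.2.IsMaximal := Ring.DimensionLEOne.maximalOfPrime h20 h2p
      have heq : a.2.2 = Q := hmax.eq_of_le hQp.ne_top (Ideal.dvd_iff_le.mp h)
      exact hNne (by rw [heq])
    exact_mod_cast card_le_card (monotone_filter_right _ fun i _ hi => by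
      obtain ⟨h12, hQi, hr⟩ := hi
      refine ⟨?_, hr.mono hzτ, (dvd_mul_right _ _).trans h12⟩
      have h2i : a.2.2 ∣ I i := (dvd_mul_left _ _).trans h12
      simpa [mul_comm] using mul_dvd_of_not_dvd hQp hQ0 hQP₂ h2i hQi)
  -- the double sum as a sum over the sigma set, then over members
  set Sg := A₁.sigma (fun a => Bs a) with hSg
  have hLHS : ∑ a ∈ A₁, ∑ Q ∈ Bs a, (#{i ∈ E | cond ⟨a, Q⟩ i} : ℝ) =
      ∑ i ∈ E, (#{x ∈ Sg | cond x i} : ℝ) := by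
    rw [← Finset.sum_sigma A₁ Bs (fun x => (#{i ∈ E | cond x i} : ℝ))]
    simp only [card_filter, Nat.cast_sum]
    exact sum_comm
  -- per member: the fibre of `x ↦ (P₂, Q)` has at most three elements
  have hfib : ∀ i ∈ E, (#{x ∈ Sg | cond x i} : ℝ) ≤ 3 * #{d ∈ D | d.1 * d.2 ∣ I i ∧ IsRough (X ^ τ) (I i)} := by
    intro i hi
    obtain ⟨hI0, hIN⟩ := hE i hi
    set Sx := Sg.filter (fun x => cond x i) with hSx
    set g : (Σ a : (Σ _ : ℕ × ℕ, Ideal (𝓞 K) × Ideal (𝓞 K)), Ideal (𝓞 K)) → Ideal (𝓞 K) × Ideal (𝓞 K) :=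
      fun x => (x.1.2.2, x.2) with hg
    have hSxmem : ∀ x ∈ Sx, x.1 ∈ A₁ ∧ x.2 ∈ Bs x.1 ∧ cond x i := fun x hx => by
      obtain ⟨hx1, hx2⟩ := mem_filter.mp hx
      exact ⟨(mem_sigma.mp hx1).1, (mem_sigma.mp hx1).2, hx2⟩
    have himg : Sx.image g ⊆ D.filter (fun d => d.1 * d.2 ∣ I i ∧ IsRough (X ^ τ) (I i)) := by
      intro d hd
      obtain ⟨x, hx, rfl⟩ := mem_image.mp hd
      obtain ⟨hxA, hxB, hc⟩ := hSxmem x hx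
      refine mem_filter.mpr ⟨?_, hc.1, hc.2.1⟩
      rw [hD, mem_biUnion]
      exact ⟨x.1, hxA, mem_image.mpr ⟨x.2, hxB, rfl⟩⟩
    have hfibre : ∀ d ∈ Sx.image g, #(Sx.filter (fun x => g x = d)) ≤ 3 := by
      intro d _
      set Fd := Sx.filter (fun x => g x = d) with hFd
      -- inject into the large prime factors of `I i` via `x ↦ P₁`
      have hinj : Set.InjOn (fun x : (Σ a : (Σ _ : ℕ × ℕ, Ideal (𝓞 K) × Ideal (𝓞 K)), Ideal (𝓞 K)) =>
          x.1.2.1) Fd := by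
        intro x hx x' hx' heq
        simp only at heq
        obtain ⟨hxS, hgx⟩ := mem_filter.mp hx
        obtain ⟨hxS', hgx'⟩ := mem_filter.mp hx'
        obtain ⟨hxA, -, -⟩ := hSxmem x hxS
        obtain ⟨hxA', -, -⟩ := hSxmem x' hxS'
        have hgg : g x = g x' := hgx.trans hgx'.symm
        simp only [hg, Prod.mk.injEq] at hgg
        obtain ⟨h22, hQQ⟩ := hgg
        obtain ⟨hnn, hP⟩ := mem_sigma.mp hxA
        obtain ⟨hnn', hP'⟩ := mem_sigma.mp hxA'
        obtain ⟨hP₁, hP₂⟩ := mem_product.mp hP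
        obtain ⟨hP₁', hP₂'⟩ := mem_product.mp hP'
        rw [heq] at hP₁; rw [h22] at hP₂
        have hn1 := Jprimes_index_unique hX hτ hP₁ hP₁'
        have hn2 := Jprimes_index_unique hX hτ hP₂ hP₂'
        obtain ⟨⟨nn, P₁, P₂⟩, Q⟩ := x
        obtain ⟨⟨nn', P₁', P₂'⟩, Q'⟩ := x'
        simp only at heq h22 hQQ hn1 hn2 ⊢
        subst heq; subst h22; subst hQQ
        have : nn = nn' := Prod.ext hn1 hn2
        subst this
        rfl
      rw [← card_image_of_injOn hinj]
      refine card_largePrimes_dvd_le_three hX hI0 hCN hIN _ fun P hP => ?_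
      obtain ⟨x, hx, rfl⟩ := mem_image.mp hP
      obtain ⟨hxS, -⟩ := mem_filter.mp hx
      obtain ⟨hxA, -, hc⟩ := hSxmem x hxS
      obtain ⟨⟨h1p, -, -, h1lo, -⟩, -⟩ := pairIndex_props hX hτ hτ1 hxA
      obtain ⟨hnnm, -⟩ := mem_sigma.mp hxA
      obtain ⟨-, h21, -, hsum⟩ := (mem_nPairs_iff hτ).mp hnnm
      refine ⟨h1p, hc.2.2, lt_of_lt_of_le ?_ h1lo⟩
      refine Real.rpow_lt_rpow_of_exponent_lt hX ?_
      have h21' : (x.1.1.2 : ℝ) + 1 ≤ x.1.1.1 := by exact_mod_cast h21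
      have : (3 / 2 + τ) ≤ ((x.1.1.1 : ℝ) + x.1.1.2) * hbXi τ := by
        have := mul_le_mul_of_nonneg_right hsum hξ.le
        rwa [div_mul_cancel₀ _ hξ.ne'] at this
      nlinarith
    calc (#Sx : ℝ) ≤ ((3 * #(Sx.image g) : ℕ) : ℝ) := by exact_mod_cast card_le_mul_card_image Sx 3 hfibre
      _ ≤ 3 * #(D.filter (fun d => d.1 * d.2 ∣ I i ∧ IsRough (X ^ τ) (I i))) := by
          push_cast
          exact mul_le_mul_of_nonneg_left (by exact_mod_cast card_le_card himg) (by norm_num)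
  -- assemble
  have hRHS : ∑ i ∈ E, (3 * #{d ∈ D | d.1 * d.2 ∣ I i ∧ IsRough (X ^ τ) (I i)} : ℝ) =
      3 * ∑ d ∈ D, (famSifted E I (d.1 * d.2) (X ^ τ) : ℝ) := by
    rw [← mul_sum]
    congr 1
    simp only [famSifted, card_filter, Nat.cast_sum]
    exact sum_comm
  calc ∑ a ∈ A₁, ∑ Q ∈ Bs a,
        (#{i ∈ E | a.2.1 * a.2.2 ∣ I i ∧ Q ∣ I i ∧ IsRough (X ^ ((a.1.2 : ℝ) * hbXi τ)) (I i)} : ℝ)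
      ≤ ∑ a ∈ A₁, ∑ Q ∈ Bs a, (#{i ∈ E | cond ⟨a, Q⟩ i} : ℝ) :=
        sum_le_sum fun a ha => sum_le_sum fun Q hQ => hpt a ha Q hQ
    _ = ∑ i ∈ E, (#{x ∈ Sg | cond x i} : ℝ) := hLHS
    _ ≤ ∑ i ∈ E, (3 * #{d ∈ D | d.1 * d.2 ∣ I i ∧ IsRough (X ^ τ) (I i)} : ℝ) := sum_le_sum hfib
    _ = _ := hRHS

end U2PairsE


/-! ## Part F: the close-pair family through Lemma 7.1; the assembled Step I bound -/

section U2PairsF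

variable {ι : Type*} (E : Finset ι) (I : ι → Ideal (𝓞 K)) {X τ C₇ C₁ M Err CN : ℝ}

open scoped Classical in
/-- **The close pairs `(P₂, Q)` through Lemma 7.1**: `∑_{(P₂,Q)} S_K(𝒵_{P₂Q}, X^τ)` is at most
`C₇ (M/(τ log X)) · L_t · 2(ξ log X + C₁)/(τ log X) · e₀ + 3 log X · C₇ Err` (the ideals `P₂Q` are
distinct of square-free norm `< X^{2−2τ}`; their patterns `{N(Q) < N(P₂) ≤ N(Q)X^ξ}` are close pairs
in `P0`). [cite: HeathBrownActa2001, §7 pp. 43, 47] -/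
theorem U2_closePairs_le (hC₁ : 0 ≤ C₁)
    (hwin : ∀ (lo hi : ℝ) (T : Finset ℕ), 2 ≤ lo → lo ≤ hi →
      (∀ p ∈ T, p.Prime ∧ lo < (p : ℝ) ∧ (p : ℝ) ≤ hi) →
      ∑ p ∈ T, (idealNormCount K p : ℝ) * (p : ℝ)⁻¹ ≤
        Real.log (Real.log hi / Real.log lo) + C₁ / Real.log lo)
    (hX : (2 : ℝ) ^ 15 ≤ X) (hτ : 0 < τ) (hτ1 : τ ≤ 1 / 8) (hXτ : 4 ≤ X ^ τ)
    (hC₇ : 0 ≤ C₇) (hM : 0 ≤ M) (hErr : 0 ≤ Err)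
    (h7 : ∀ (N z : ℝ) (𝒬 : Finset ℕ), X ^ τ ≤ z → 0 < N → N ≤ X ^ (2 - 2 * τ) →
        (∀ q ∈ 𝒬, Squarefree q ∧ N < q ∧ (q : ℝ) ≤ 2 * N) →
        ∑ Q ∈ normIn 𝒬, (famSifted E I Q z : ℝ) ≤
          C₇ * (M / Real.log (min z (X ^ (2 - τ) / N)) *
            ∑ Q ∈ normIn 𝒬, ((Ideal.absNorm Q : ℕ) : ℝ)⁻¹ + Err)) :
    ∑ d ∈ ((nPairs τ).sigma (fun nn => Jprimes X τ nn.1 ×ˢ Jprimes X τ nn.2)).biUnion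
          (fun a => (((idealsLE (Ideal.absNorm a.2.2)).filter
            (fun Q => Q.IsPrime ∧ Q ≠ ⊥ ∧ X ^ ((a.1.2 : ℝ) * hbXi τ) ≤ (Ideal.absNorm Q : ℝ) ∧
              PrimeLT Q a.2.2)).filter
            (fun Q => (Ideal.absNorm Q).Prime ∧ Ideal.absNorm Q ≠ Ideal.absNorm a.2.2)).image
            (fun Q => (a.2.2, Q))),
        (famSifted E I (d.1 * d.2) (X ^ τ) : ℝ) ≤
      C₇ * (M / (τ * Real.log X)) *
        ((∑ p ∈ (range (⌊X ^ (1 - τ)⌋₊ + 1)).filter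
            (fun p : ℕ => p.Prime ∧ X ^ τ ≤ (p : ℝ) ∧ (p : ℝ) < X ^ (1 - τ)), (idealNormCount K p : ℝ) * (p : ℝ)⁻¹) *
          (2 * (hbXi τ * Real.log X + C₁) / (τ * Real.log X)) *
            ∑ σ' ∈ ((range (⌊X ^ (1 - τ)⌋₊ + 1)).filter
                (fun p : ℕ => p.Prime ∧ X ^ τ ≤ (p : ℝ) ∧ (p : ℝ) < X ^ (1 - τ))).powersetCard 0,
              ∏ p ∈ σ', (idealNormCount K p : ℝ) * (p : ℝ)⁻¹) +
        3 * Real.log X * (C₇ * Err) := by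
  classical
  have hX1 : 1 < X := lt_of_lt_of_le (by norm_num) hX
  have hX0 : 0 < X := by linarith
  have hτ4 : τ ≤ 1 / 4 := by linarith
  have hξ := hbXi_pos hτ
  set A₁ := (nPairs τ).sigma (fun nn => Jprimes X τ nn.1 ×ˢ Jprimes X τ nn.2) with hA₁
  set Bs : (Σ _ : ℕ × ℕ, Ideal (𝓞 K) × Ideal (𝓞 K)) → Finset (Ideal (𝓞 K)) := fun a =>
    ((idealsLE (Ideal.absNorm a.2.2)).filter
      (fun Q => Q.IsPrime ∧ Q ≠ ⊥ ∧ X ^ ((a.1.2 : ℝ) * hbXi τ) ≤ (Ideal.absNorm Q : ℝ) ∧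
        PrimeLT Q a.2.2)).filter
      (fun Q => (Ideal.absNorm Q).Prime ∧ Ideal.absNorm Q ≠ Ideal.absNorm a.2.2) with hBs
  set D := A₁.biUnion (fun a => (Bs a).image (fun Q => (a.2.2, Q))) with hD
  set P0 := (range (⌊X ^ (1 - τ)⌋₊ + 1)).filter
    (fun p : ℕ => p.Prime ∧ X ^ τ ≤ (p : ℝ) ∧ (p : ℝ) < X ^ (1 - τ)) with hP0
  change ∑ d ∈ D, (famSifted E I (d.1 * d.2) (X ^ τ) : ℝ) ≤
    C₇ * (M / (τ * Real.log X)) *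
      ((∑ p ∈ P0, (idealNormCount K p : ℝ) * (p : ℝ)⁻¹) * (2 * (hbXi τ * Real.log X + C₁) / (τ * Real.log X)) *
        ∑ σ' ∈ P0.powersetCard 0, ∏ p ∈ σ', (idealNormCount K p : ℝ) * (p : ℝ)⁻¹) +
      3 * Real.log X * (C₇ * Err)
  -- the members of `D`
  have hDmem : ∀ d ∈ D, d.1.IsPrime ∧ d.1 ≠ ⊥ ∧ d.2.IsPrime ∧ d.2 ≠ ⊥ ∧ (Ideal.absNorm d.1).Prime ∧
      (Ideal.absNorm d.2).Prime ∧ Ideal.absNorm d.2 < Ideal.absNorm d.1 ∧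
      X ^ τ ≤ (Ideal.absNorm d.2 : ℝ) ∧ (Ideal.absNorm d.1 : ℝ) < X ^ (1 - τ) ∧
      (Ideal.absNorm d.1 : ℝ) < Ideal.absNorm d.2 * X ^ hbXi τ := by
    intro d hd
    rw [hD, mem_biUnion] at hd
    obtain ⟨a, ha, hd⟩ := hd
    obtain ⟨Q, hQ, rfl⟩ := mem_image.mp hd
    obtain ⟨-, ⟨h2p, h20, h2n, h2lo, h2hi⟩, hzτ, h21N, h1small, -⟩ := pairIndex_props hX1 hτ hτ4 ha
    simp only [hBs, mem_filter] at hQ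
    obtain ⟨⟨-, hQp, hQ0, hQz, hQlt⟩, hQn, hQne⟩ := hQ
    have hNlt : Ideal.absNorm Q < Ideal.absNorm a.2.2 := lt_of_le_of_ne hQlt.absNorm_le hQne
    refine ⟨h2p, h20, hQp, hQ0, h2n, hQn, hNlt, hzτ.trans hQz, h21N.trans h1small, ?_⟩
    calc (Ideal.absNorm a.2.2 : ℝ) < X ^ (((a.1.2 : ℝ) + 1) * hbXi τ) := h2hi
      _ = X ^ ((a.1.2 : ℝ) * hbXi τ) * X ^ hbXi τ := by rw [← Real.rpow_add hX0]; ring_nf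
      _ ≤ Ideal.absNorm Q * X ^ hbXi τ := mul_le_mul_of_nonneg_right hQz (by positivity)
  -- re-index by the ideal `P₂ Q`
  have hinj : Set.InjOn (fun d : Ideal (𝓞 K) × Ideal (𝓞 K) => d.1 * d.2) D := by
    intro d hd d' hd' h
    obtain ⟨h1p, h10, h2p, h20, -, -, hlt, -⟩ := hDmem d hd
    obtain ⟨h1p', h10', h2p', h20', -, -, hlt', -⟩ := hDmem d' hd'
    obtain ⟨e1, e2⟩ := pair_eq_of_mul_eq h1p h10 h2p h20 h1p' h10' h2p' h20' hlt hlt' h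
    exact Prod.ext e1 e2
  rw [← sum_image (f := fun Q => (famSifted E I Q (X ^ τ) : ℝ)) hinj]
  have hTimg : ∀ R ∈ D.image (fun d => d.1 * d.2), Squarefree (Ideal.absNorm R) ∧
      (2 : ℝ) ≤ (Ideal.absNorm R : ℝ) ∧ (Ideal.absNorm R : ℝ) < X ^ (2 - 2 * τ) := by
    intro R hR
    obtain ⟨d, hd, rfl⟩ := mem_image.mp hR
    obtain ⟨-, -, -, -, h1n, h2n, hlt, h2lo, h1hi, -⟩ := hDmem d hd
    refine ⟨?_, ?_, ?_⟩
    · rw [map_mul, Nat.squarefree_mul_iff]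
      exact ⟨(Nat.coprime_primes h1n h2n).mpr hlt.ne', h1n.squarefree, h2n.squarefree⟩
    · rw [map_mul, Nat.cast_mul]
      have h1 : (2 : ℝ) ≤ Ideal.absNorm d.1 := by exact_mod_cast h1n.two_le
      have h2 : (1 : ℝ) ≤ Ideal.absNorm d.2 := by exact_mod_cast h2n.one_lt.le
      nlinarith
    · rw [map_mul, Nat.cast_mul]
      have h2hi : (Ideal.absNorm d.2 : ℝ) < X ^ (1 - τ) := lt_trans (by exact_mod_cast hlt) h1hi
      calc (Ideal.absNorm d.1 : ℝ) * Ideal.absNorm d.2 < X ^ (1 - τ) * X ^ (1 - τ) :=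
            mul_lt_mul'' h1hi h2hi (Nat.cast_nonneg _) (Nat.cast_nonneg _)
        _ = X ^ (2 - 2 * τ) := by rw [← Real.rpow_add hX0]; ring_nf
  have step2 := sum_sifted_le_of_h7 E I hX hτ hτ1 hC₇ hM hErr h7 _ hTimg
  refine step2.trans (add_le_add (mul_le_mul_of_nonneg_left ?_
    (mul_nonneg hC₇ (div_nonneg hM (mul_nonneg hτ.le (Real.log_nonneg hX1.le))))) le_rfl)
  -- the weight through the close patterns `{N(Q), N(P₂)}`
  set pat : Ideal (𝓞 K) × Ideal (𝓞 K) → Finset ℕ := fun d => {Ideal.absNorm d.2, Ideal.absNorm d.1} with hpat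
  have hpatprops : ∀ d ∈ D, pat d ∈ P0.powersetCard 2 ∧ ∏ p ∈ pat d, p = Ideal.absNorm (d.1 * d.2) ∧
      (∀ p ∈ pat d, p.Prime) := by
    intro d hd
    obtain ⟨-, -, -, -, h1n, h2n, hlt, h2lo, h1hi, -⟩ := hDmem d hd
    have hne : Ideal.absNorm d.2 ≠ Ideal.absNorm d.1 := hlt.ne
    have h2hi : (Ideal.absNorm d.2 : ℝ) < X ^ (1 - τ) := lt_trans (by exact_mod_cast hlt) h1hi
    have h1lo : X ^ τ ≤ (Ideal.absNorm d.1 : ℝ) := h2lo.trans (by exact_mod_cast hlt.le)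
    refine ⟨mem_powersetCard.mpr ⟨?_, ?_⟩, ?_, ?_⟩
    · intro p hp
      simp only [hpat, mem_insert, mem_singleton] at hp
      rcases hp with rfl | rfl
      · exact mem_P0_iff.mpr ⟨h2n, h2lo, h2hi⟩
      · exact mem_P0_iff.mpr ⟨h1n, h1lo, h1hi⟩
    · simp only [hpat]; rw [card_insert_of_notMem (by simpa using hne), card_singleton]
    · simp only [hpat]; rw [prod_insert (by simpa using hne), prod_singleton, map_mul, mul_comm]
    · intro p hp
      simp only [hpat, mem_insert, mem_singleton] at hp
      rcases hp with rfl | rfl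
      · exact h2n
      · exact h1n
  have step3 : ∑ q ∈ (D.image fun d => d.1 * d.2).image Ideal.absNorm, (idealNormCount K q : ℝ) * (q : ℝ)⁻¹ ≤
      ∑ σ ∈ D.image pat, ∏ p ∈ σ, (idealNormCount K p : ℝ) * (p : ℝ)⁻¹ := by
    have heq : (D.image fun d => d.1 * d.2).image Ideal.absNorm = (D.image pat).image (fun σ => ∏ p ∈ σ, p) := by
      rw [image_image, image_image]
      refine image_congr fun d hd => ?_
      simp only [Function.comp_apply]
      exact ((hpatprops d hd).2.1).symm
    rw [heq]
    refine sum_image_prod_normWt_le _ fun σ hσ p hp => ?_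
    obtain ⟨d, hd, rfl⟩ := mem_image.mp hσ
    exact (hpatprops d hd).2.2 p hp
  refine step3.trans ?_
  have hP0mem : ∀ p ∈ P0, p.Prime ∧ X ^ τ ≤ (p : ℝ) := fun p hp =>
    ⟨(mem_P0_iff.mp hp).1, (mem_P0_iff.mp hp).2.1⟩
  have hρ : (1 : ℝ) ≤ X ^ hbXi τ := Real.one_le_rpow hX1.le hξ.le
  have h := sum_class_close_le P0 hC₁ hwin hX1 hτ hXτ hP0mem (D.image pat)
    (fun σ hσ => by obtain ⟨d, hd, rfl⟩ := mem_image.mp hσ; exact (hpatprops d hd).1) hρ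
    (fun σ hσ => by
      obtain ⟨d, hd, rfl⟩ := mem_image.mp hσ
      obtain ⟨-, -, -, -, -, -, hlt, -, -, hclose⟩ := hDmem d hd
      refine ⟨Ideal.absNorm d.2, by simp [hpat], Ideal.absNorm d.1, by simp [hpat], hlt, hclose.le⟩)
  rw [Real.log_rpow hX0] at h
  exact h

variable {E I}

open scoped Classical in
/-- The Buchstab count at `(P₁P₂, Q)` is at most `#𝒵_{Q·P₁P₂}` (`Q ≺ P₂ ≺ P₁` is coprime to `P₁P₂`).
[folklore] -/
theorem buchstabCount_le_famCount (hX : 1 < X) (hτ : 0 < τ) (hτ1 : τ ≤ 1 / 4)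
    {a : Σ _ : ℕ × ℕ, Ideal (𝓞 K) × Ideal (𝓞 K)}
    (ha : a ∈ (nPairs τ).sigma (fun nn => Jprimes X τ nn.1 ×ˢ Jprimes X τ nn.2))
    {Q : Ideal (𝓞 K)} (hQp : Q.IsPrime) (hQ0 : Q ≠ ⊥) (hQlt : PrimeLT Q a.2.2) (z : ℝ) :
    #{i ∈ E | a.2.1 * a.2.2 ∣ I i ∧ Q ∣ I i ∧ IsRough z (I i)} ≤ famCount E I (Q * (a.2.1 * a.2.2)) := by
  classical
  obtain ⟨⟨h1p, h10, -⟩, ⟨h2p, h20, -⟩, -, -, -, -, -, hlt, -⟩ := pairIndex_props hX hτ hτ1 ha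
  have hmax1 : a.2.1.IsMaximal := Ring.DimensionLEOne.maximalOfPrime h10 h1p
  have hmax2 : a.2.2.IsMaximal := Ring.DimensionLEOne.maximalOfPrime h20 h2p
  have hQ1 : Q ≠ a.2.1 := (hQlt.trans hlt).ne
  have hQ2 : Q ≠ a.2.2 := hQlt.ne
  have hndvd : ¬ Q ∣ a.2.1 * a.2.2 := by
    intro h
    rcases (Ideal.prime_of_isPrime hQ0 hQp).dvd_or_dvd h with h' | h'
    · exact hQ1 (hmax1.eq_of_le hQp.ne_top (Ideal.dvd_iff_le.mp h')).symm
    · exact hQ2 (hmax2.eq_of_le hQp.ne_top (Ideal.dvd_iff_le.mp h')).symm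
  unfold famCount
  exact card_le_card (monotone_filter_right _ fun i _ hi => mul_dvd_of_not_dvd hQp hQ0 hndvd hi.1 hi.2.1)

end U2PairsF


/-! ## Part G: Step I assembled -/

section U2PairsG

variable {ι : Type*} (E : Finset ι) (I : ι → Ideal (𝓞 K)) {X τ C₇ C₁ M Err CN : ℝ}

open scoped Classical in
/-- **Step I for `U₂^(1)`, general family** (Lemma 7.1 as hypothesis `h7`): with
`V = ∑_{(𝐧,P₁,P₂)} S_K(𝒵_{P₁P₂}, X^{n₂ξ})`, `w(p) = c_K(p)/p`, `P0 = {X^τ ≤ p < X^{1−τ}}`, `e_j` its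
elementary symmetric sums, `L_t = ∑_{P0} w`, `B = 2(2ξ log X + log 2 + C₁)/(τ log X)`,
`B_c = 2(ξ log X + C₁)/(τ log X)`:
`|U₂^(1) − V| ≤ E1p + E3p + C₇ M/(τ log X)·(3B e₁ + L_t B e₀ + 3 L_t B_c e₀) + 12 log X · C₇ Err`,
where E1p (non-good pairs) and E3p (Buchstab primes of degree `≥ 2` or of norm `N(P₂)`) are the raw
family-dependent terms. [cite: HeathBrownActa2001, §7 pp. 46–47] -/
theorem U2_pairs_bound_of_h7 (hC₁ : 0 ≤ C₁)
    (hwin : ∀ (lo hi : ℝ) (T : Finset ℕ), 2 ≤ lo → lo ≤ hi →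
      (∀ p ∈ T, p.Prime ∧ lo < (p : ℝ) ∧ (p : ℝ) ≤ hi) →
      ∑ p ∈ T, (idealNormCount K p : ℝ) * (p : ℝ)⁻¹ ≤
        Real.log (Real.log hi / Real.log lo) + C₁ / Real.log lo)
    (hX : (2 : ℝ) ^ 15 ≤ X) (hτ : 0 < τ) (hτ1 : τ ≤ 1 / 8) (hXτ : 4 ≤ X ^ τ)
    (hCN : CN ≤ X ^ (2 * τ)) (hE : ∀ i ∈ E, I i ≠ ⊥ ∧ (Ideal.absNorm (I i) : ℝ) ≤ CN * X ^ 3)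
    (hC₇ : 0 ≤ C₇) (hM : 0 ≤ M) (hErr : 0 ≤ Err)
    (h7 : ∀ (N z : ℝ) (𝒬 : Finset ℕ), X ^ τ ≤ z → 0 < N → N ≤ X ^ (2 - 2 * τ) →
        (∀ q ∈ 𝒬, Squarefree q ∧ N < q ∧ (q : ℝ) ≤ 2 * N) →
        ∑ Q ∈ normIn 𝒬, (famSifted E I Q z : ℝ) ≤
          C₇ * (M / Real.log (min z (X ^ (2 - τ) / N)) *
            ∑ Q ∈ normIn 𝒬, ((Ideal.absNorm Q : ℕ) : ℝ)⁻¹ + Err)) :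
    |(U2one E I X τ : ℝ) -
        ∑ a ∈ (nPairs τ).sigma (fun nn => Jprimes X τ nn.1 ×ˢ Jprimes X τ nn.2),
          (famSifted E I (a.2.1 * a.2.2) (X ^ ((a.1.2 : ℝ) * hbXi τ)) : ℝ)| ≤
      ∑ t ∈ (Upairs X τ 1).filter (fun t => ¬ UGood t), (famCount E I (uIdeal t) : ℝ) +
      ∑ a ∈ (nPairs τ).sigma (fun nn => Jprimes X τ nn.1 ×ˢ Jprimes X τ nn.2),
        ∑ Q ∈ ((idealsLE (Ideal.absNorm a.2.2)).filter
            (fun Q => Q.IsPrime ∧ Q ≠ ⊥ ∧ X ^ ((a.1.2 : ℝ) * hbXi τ) ≤ (Ideal.absNorm Q : ℝ) ∧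
              PrimeLT Q a.2.2)).filter
            (fun Q => ¬ ((Ideal.absNorm Q).Prime ∧ Ideal.absNorm Q ≠ Ideal.absNorm a.2.2)),
          (famCount E I (Q * (a.2.1 * a.2.2)) : ℝ) +
      C₇ * (M / (τ * Real.log X)) *
        (3 * (2 * (2 * hbXi τ * Real.log X + Real.log 2 + C₁) / (τ * Real.log X)) *
            ∑ σ' ∈ ((range (⌊X ^ (1 - τ)⌋₊ + 1)).filter
                (fun p : ℕ => p.Prime ∧ X ^ τ ≤ (p : ℝ) ∧ (p : ℝ) < X ^ (1 - τ))).powersetCard 1,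
              ∏ p ∈ σ', (idealNormCount K p : ℝ) * (p : ℝ)⁻¹ +
          (∑ p ∈ (range (⌊X ^ (1 - τ)⌋₊ + 1)).filter
              (fun p : ℕ => p.Prime ∧ X ^ τ ≤ (p : ℝ) ∧ (p : ℝ) < X ^ (1 - τ)), (idealNormCount K p : ℝ) * (p : ℝ)⁻¹) *
            (2 * (2 * hbXi τ * Real.log X + Real.log 2 + C₁) / (τ * Real.log X)) *
            ∑ σ' ∈ ((range (⌊X ^ (1 - τ)⌋₊ + 1)).filter
                (fun p : ℕ => p.Prime ∧ X ^ τ ≤ (p : ℝ) ∧ (p : ℝ) < X ^ (1 - τ))).powersetCard 0,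
              ∏ p ∈ σ', (idealNormCount K p : ℝ) * (p : ℝ)⁻¹ +
          3 * ((∑ p ∈ (range (⌊X ^ (1 - τ)⌋₊ + 1)).filter
              (fun p : ℕ => p.Prime ∧ X ^ τ ≤ (p : ℝ) ∧ (p : ℝ) < X ^ (1 - τ)), (idealNormCount K p : ℝ) * (p : ℝ)⁻¹) *
            (2 * (hbXi τ * Real.log X + C₁) / (τ * Real.log X)) *
            ∑ σ' ∈ ((range (⌊X ^ (1 - τ)⌋₊ + 1)).filter
                (fun p : ℕ => p.Prime ∧ X ^ τ ≤ (p : ℝ) ∧ (p : ℝ) < X ^ (1 - τ))).powersetCard 0,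
              ∏ p ∈ σ', (idealNormCount K p : ℝ) * (p : ℝ)⁻¹)) +
      12 * Real.log X * (C₇ * Err) := by
  classical
  have hX1 : 1 < X := lt_of_lt_of_le (by norm_num) hX
  have hX0 : 0 < X := by linarith
  have hτ4 : τ ≤ 1 / 4 := by linarith
  have h0 : ∀ i ∈ E, I i ≠ ⊥ := fun i hi => (hE i hi).1
  set A₁ := (nPairs τ).sigma (fun nn => Jprimes X τ nn.1 ×ˢ Jprimes X τ nn.2) with hA₁
  set Bset : (Σ _ : ℕ × ℕ, Ideal (𝓞 K) × Ideal (𝓞 K)) → Finset (Ideal (𝓞 K)) := fun a =>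
    (idealsLE (Ideal.absNorm a.2.2)).filter
      (fun Q => Q.IsPrime ∧ Q ≠ ⊥ ∧ X ^ ((a.1.2 : ℝ) * hbXi τ) ≤ (Ideal.absNorm Q : ℝ) ∧
        PrimeLT Q a.2.2) with hBset
  set good : (Σ _ : ℕ × ℕ, Ideal (𝓞 K) × Ideal (𝓞 K)) → Ideal (𝓞 K) → Prop := fun a Q =>
    (Ideal.absNorm Q).Prime ∧ Ideal.absNorm Q ≠ Ideal.absNorm a.2.2 with hgood
  -- the raw inequality
  have hraw := U2_pairs_abs_sub_le (E := E) (I := I) hX1 hτ hτ4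
  -- the unmatched pairs
  have hunm := U2_unmatched_sum_le E I hC₁ hwin hX hτ hτ1 hXτ hC₇ hM hErr h7
  -- the Buchstab term
  have hbuch : ∑ a ∈ A₁, ((famSifted E I (a.2.1 * a.2.2) (X ^ ((a.1.2 : ℝ) * hbXi τ)) : ℝ) -
      famSiftedAbove E I (a.2.1 * a.2.2) a.2.2) ≤
      3 * (C₇ * (M / (τ * Real.log X)) *
        ((∑ p ∈ (range (⌊X ^ (1 - τ)⌋₊ + 1)).filter
            (fun p : ℕ => p.Prime ∧ X ^ τ ≤ (p : ℝ) ∧ (p : ℝ) < X ^ (1 - τ)), (idealNormCount K p : ℝ) * (p : ℝ)⁻¹) *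
          (2 * (hbXi τ * Real.log X + C₁) / (τ * Real.log X)) *
            ∑ σ' ∈ ((range (⌊X ^ (1 - τ)⌋₊ + 1)).filter
                (fun p : ℕ => p.Prime ∧ X ^ τ ≤ (p : ℝ) ∧ (p : ℝ) < X ^ (1 - τ))).powersetCard 0,
              ∏ p ∈ σ', (idealNormCount K p : ℝ) * (p : ℝ)⁻¹) +
        3 * Real.log X * (C₇ * Err)) +
      ∑ a ∈ A₁, ∑ Q ∈ (Bset a).filter (fun Q => ¬ good a Q), (famCount E I (Q * (a.2.1 * a.2.2)) : ℝ) := by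
    -- `famSifted − famSiftedAbove ≤ ∑_{Q ∈ Bset} cnt`
    have h1 : ∀ a ∈ A₁, ((famSifted E I (a.2.1 * a.2.2) (X ^ ((a.1.2 : ℝ) * hbXi τ)) : ℝ) -
        famSiftedAbove E I (a.2.1 * a.2.2) a.2.2) ≤
        ∑ Q ∈ Bset a, (#{i ∈ E | a.2.1 * a.2.2 ∣ I i ∧ Q ∣ I i ∧
          IsRough (X ^ ((a.1.2 : ℝ) * hbXi τ)) (I i)} : ℝ) :=
      fun a _ => famSifted_sub_famSiftedAbove_le E I h0 _ _ _
    refine (sum_le_sum h1).trans ?_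
    -- split `Bset` into good and bad primes
    have h2 : ∀ a ∈ A₁, ∑ Q ∈ Bset a, (#{i ∈ E | a.2.1 * a.2.2 ∣ I i ∧ Q ∣ I i ∧
          IsRough (X ^ ((a.1.2 : ℝ) * hbXi τ)) (I i)} : ℝ) =
        ∑ Q ∈ (Bset a).filter (fun Q => good a Q), (#{i ∈ E | a.2.1 * a.2.2 ∣ I i ∧ Q ∣ I i ∧
          IsRough (X ^ ((a.1.2 : ℝ) * hbXi τ)) (I i)} : ℝ) +
        ∑ Q ∈ (Bset a).filter (fun Q => ¬ good a Q), (#{i ∈ E | a.2.1 * a.2.2 ∣ I i ∧ Q ∣ I i ∧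
          IsRough (X ^ ((a.1.2 : ℝ) * hbXi τ)) (I i)} : ℝ) :=
      fun a _ => (sum_filter_add_sum_filter_not _ _ _).symm
    rw [sum_congr rfl h2, sum_add_distrib]
    refine add_le_add ?_ ?_
    · -- good primes: close pairs, multiplicity three, Lemma 7.1
      have hg := U2_buchstab_good_le E I hX1 hτ hτ4 hCN hE
      have hc := U2_closePairs_le E I hC₁ hwin hX hτ hτ1 hXτ hC₇ hM hErr h7
      exact hg.trans (by linarith [hc])
    · -- bad primes: `cnt ≤ #𝒵_{Q P₁P₂}`
      refine sum_le_sum fun a ha => sum_le_sum fun Q hQ => ?_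
      obtain ⟨hQB, -⟩ := mem_filter.mp hQ
      simp only [hBset, mem_filter] at hQB
      obtain ⟨-, hQp, hQ0, -, hQlt⟩ := hQB
      exact_mod_cast buchstabCount_le_famCount hX1 hτ hτ4 ha hQp hQ0 hQlt _
  -- combine
  have hsum := add_le_add hunm hbuch
  refine hraw.trans (hsum.trans (le_of_eq ?_))
  ring

end U2PairsG

end Literature.NumberTheory.Sieve.CubicSieve

end
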